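import Summits.ResolutionOfSingularities.ResolutionOfSingularities.Theses.RadicialJung
import Summits.ResolutionOfSingularities.ResolutionOfSingularities.Theorems.RadicialJungCleanModelsT2CleanModelsDimLETwoOverField
import Summits.ResolutionOfSingularities.ResolutionOfSingularities.Theorems.RadicialJungCleanModelsReductionAt
import Summits.ResolutionOfSingularities.ResolutionOfSingularities.Theorems.RadicialJungCleanModelsStubStacks0BICLocus
import Summits.ResolutionOfSingularities.ResolutionOfSingularities.Theorems.RadicialJungCleanModelsCleanPatchingDefs
import Summits.ResolutionOfSingularities.ResolutionOfSingularities.Theorems.RadicialJungCleanModelsStubCleanCharts3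
import Summits.ResolutionOfSingularities.ResolutionOfSingularities.Theorems.RadicialJungCleanModelsStubCleanTwoModelPatching3
import Summits.ResolutionOfSingularities.ResolutionOfSingularities.Theorems.RadicialJungCleanModelsStubCleanGlobalization3
import Summits.ResolutionOfSingularities.ResolutionOfSingularities.Theorems.RadicialJungCleanModelsStubCleanPointBlowup
import Summits.ResolutionOfSingularities.ResolutionOfSingularities.Theorems.RadicialJungCleanModelsCleanPrincipalizationOfProp44
import Summits.ResolutionOfSingularities.ResolutionOfSingularities.Theorems.RadicialJungCleanModelsCleanLU3Defectless
import Summits.ResolutionOfSingularities.ResolutionOfSingularities.Theorems.RadicialJungCleanModelsCleanLU3Abhyankar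
import Summits.ResolutionOfSingularities.ResolutionOfSingularities.Theorems.RadicialJungCleanModelsCleanCharts3ZeroDim
import Summits.ResolutionOfSingularities.ResolutionOfSingularities.Theorems.RadicialJungCleanModelsStubCjs2020Cor15
import Summits.ResolutionOfSingularities.ResolutionOfSingularities.Theorems.RadicialJungCleanModelsCleanLU3ArcDischarge
import Summits.ResolutionOfSingularities.ResolutionOfSingularities.Theorems.RadicialJungCleanModelsCleanLU3ArcDiscrete
import Summits.ResolutionOfSingularities.ResolutionOfSingularities.Theorems.RadicialJungCleanModelsCleanLU3CompositeCdiv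
import Summits.ResolutionOfSingularities.ResolutionOfSingularities.Theorems.RadicialJungCleanModelsCleanLU3CompositeCdivCP
import Summits.ResolutionOfSingularities.ResolutionOfSingularities.Theorems.RadicialJungCleanModelsLens5PRankTwoPort5
import Summits.ResolutionOfSingularities.ResolutionOfSingularities.Theorems.RadicialJungCleanModelsLens5TFramePDegreeC
import Summits.ResolutionOfSingularities.ResolutionOfSingularities.Theorems.RadicialJungCleanModelsLens5TFrameSepConst
import Summits.ResolutionOfSingularities.ResolutionOfSingularities.Theorems.RadicialJungCleanModelsLens5PTwoSlice
import Summits.ResolutionOfSingularities.ResolutionOfSingularities.Theorems.RadicialJungCleanModelsLens5KbarCossart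
import Summits.ResolutionOfSingularities.ResolutionOfSingularities.Theorems.RadicialJungCleanModelsCcurveMain
import Summits.ResolutionOfSingularities.ResolutionOfSingularities.Theorems.RadicialJungCleanModelsCcurveMainGen
import Summits.ResolutionOfSingularities.ResolutionOfSingularities.Theorems.RadicialJungCleanModelsConeExitMorse
import Summits.ResolutionOfSingularities.ResolutionOfSingularities.Theorems.RadicialJungCleanModelsConeExitSmooth
import Literature.AlgebraicGeometry.Resolution.CossartFunctionNormalForm3
import Literature.AlgebraicGeometry.Resolution.TranscendenceDefect
import Literature.AlgebraicGeometry.Resolution.BadCurveInduction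
import Literature.AlgebraicGeometry.Resolution.EmbeddedResolutionCurvesInSurfaces
import Literature.AlgebraicGeometry.Resolution.LocalBlowup
import Literature.AlgebraicGeometry.Resolution.ExcellentRings
import Summits.ResolutionOfSingularities.ResolutionOfSingularities.Theorems.RadicialJungCleanModelsCleanLU3DefectlessOfThm11
import Summits.ResolutionOfSingularities.ResolutionOfSingularities.Theorems.RadicialJungCleanModelsCleanLU3CompositeCdivCPOfThm11
import Summits.ResolutionOfSingularities.ResolutionOfSingularities.Theorems.RadicialJungCleanModelsLens5PRankTwoPort5OfThm11
import Summits.ResolutionOfSingularities.ResolutionOfSingularities.Theorems.RadicialJungCleanModelsLens5TFramePMonOfThm11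
import Summits.ResolutionOfSingularities.ResolutionOfSingularities.Theorems.RadicialJungCleanModelsLens5TFrameCompositionInfOfThm11
import Summits.ResolutionOfSingularities.ResolutionOfSingularities.Theorems.RadicialJungCleanModelsKbarLUOfCossartRational
import Summits.ResolutionOfSingularities.ResolutionOfSingularities.Theorems.RadicialJungCleanModelsKbarQuasiProjectiveModel
import HarnessLib

/-!
# CANDIDATE RESHAPE «rev 36″» by decomp-res-hand-1 (g24, 2026-09-01) = the MERGE of the two unregistered hand-1 re-accountings — NOT registered (the lead / steward decides).
# SIX stubs instead of seven: printed {`stub_cp2019Thm11` (CP 2019 Thm 1.1 VERBATIM (i)(ii)(iii)), `stub_cossart1987ThmRational` (Cossart 1987 for a RATIONAL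
# function = Posva 2024 Claim 5.1.2), `stub_cp2019Thm15iBaseSidePhaseTwo` (wi-91399 @ p = 2)} + research {`stub_cleanLU3DefectNonDiscrete` (class (B)),
# `stub_cleanProp44` (X44c)} + frontier `stub_cleanModelsDimGEFour`.  (a) From g0's `Lines/Sketch_hand1_thm11.lean` (2026-08-30): `stub_cjs2020Thm14` (F-32)
# and `stub_cjs2020Cor15` are GONE, `stub_cossartPiltant2019` (F-02) is DERIVED from `stub_cp2019Thm11` (✓ `CP2019.CossartPiltant2019Thm11.cossartPiltant2019`),
# every former use of F-32 (all of them the `hEmb` shape for a hypersurface `V(x) ⊂ Spec R`, `dim R ≤ 3`) goes through the KERNEL engine ✓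
# `Doubling.hEmb_zeroLocus_of_thm11` via the landed `_thm11` re-threadings.  (b) From g22/g23's `Lines/Sketch_hand1_g2{2_kbar,3_kbar1}.lean`: F-112
# `stub_cossart1987Thm` (Cossart 1987 for a GLOBAL function) is REPLACED by `stub_cossart1987ThmRational` (same source, the twin every `k̄` consumer needs),
# consumed in `cleanLU3DefectNonDiscrete_of_stubs` through ✓ `KbarRational.cleanLU3DefectNonDiscrete_algClosed_of_cossartRational` (p837090); and the
# dim-`≤ 3` branch of `CleanModels_of` OPENS with `by_cases halg : IsAlgClosed k` closed by ONE `exact` on ✓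
# `KbarQuasiProjective.cleanModels_algClosed_dimLEThree_of_cossartRational` (p838114: EVERY regular `W`, no LU, no patching) — so stubs 1, 3, 4, 5 serve
# NON-algebraically-closed ground fields only.  Sorry-free certificate of this composition with the six stubs as hypotheses: ✓/⧗
# `Theorems/RadicialJungCleanModelsOfInputsRational.lean` (`OfInputsRational.cleanModels_of_inputs`, p838543).  Every other byte as in rev 35
# (sha16 de44649d8f729c3b).  INPUT LEDGER BY CELL: dim ≤ 2 — nothing (F-75c ✓); dim 3, k = k̄ — Rational alone; dim 3, k ≠ k̄, p = 2 — wi-91399@2 + X44c;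
# dim 3, k ≠ k̄, p odd — Thm11 + class (B) + X44c; dim ≥ 4 — frontier.  Nothing here proves resolution in characteristic p.
#

# Skeleton `Sketch` (rev 35 — the MORSE binder of rev 34 GENERALISED to the SMOOTH-CONE binder (lead g10, ✓ `Theorems/RadicialJungCleanModelsConeExitSmooth{Prelims,}.lean`,
# p759193 / p759486): the research stub `stub_cleanLU3DefectNonDiscrete` now carries «at NO finitely generated model `A ⊆ A' ⊆ O`, regular at the centre of `O`, does the
# `K^p`-line of `g₀` have a representative `h ≡ F(t) (mod 𝔪^{e+1})` with `F` homogeneous of degree `e` PRIME TO `p` whose projectivised tangent cone `V(F̄)` is SMOOTH»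
# (Jacobian form lifted to the local ring: `t_i^N ≡ Σ_k b_{ik} (∂_k F)(t) (mod 𝔪^{N+1})`, `b_{ik} ∈ 𝔪^{N+1-e}`); at such a stage ONE quadratic transform along `O` makes the
# line loosely clean for EVERY valuation (✓ `ConeExit.cleanLUConcl_of_smoothCone`: the centre of `O` is never a singular point of a smooth cone); the `e = 2` instances are
# the Morse stages of rev 34 (✓ `ConeExit.cleanLUConcl_of_nondegenerate` remains a landed helper), so rev 35 is a NARROWING of rev 34; 7 stubs unchanged in number, PRICE
# untouched; rev 34 — the research stub `stub_cleanLU3DefectNonDiscrete` NARROWED by the MORSE EXIT (lead g10, ✓ `Theorems/RadicialJungCleanModelsConeExit{Prelims,,MorsePrelims,Morse}.lean`,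
# p757004 / p757309 / p758013 / p758396): PLUS the hypothesis «at NO finitely generated model `A ⊆ A' ⊆ O`, regular at the centre of `O`, does the `K^p`-line of `g₀` have a
# representative `h ≡ Q(t) (mod 𝔪³)` whose quadratic form `Q` has NONDEGENERATE polars (`𝔪 = (Σ_j (a_kj + a_jk) t_j)_k + 𝔪²`)» — at such a MORSE stage ONE quadratic
# transform along `O` makes the line loosely clean for EVERY valuation (the projective quadric `V(Q̄)` has no singular point: ✓ `ConeExit.cleanLUConcl_of_nondegenerate`,
# `p ≠ 2`), one more `by_cases` in `cleanLU3DefectNonDiscrete_of_stubs`; with ✓ `ConeExit.cleanLUConcl_or_firstReturn_of_cp2019BaseSidePhase` (every `p`, mod wi-91399: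
# after the printed base-side phase, clean unless the valuation's next centre is a SINGULAR point of the tangent cone of `h = g_n - c₀^p`, `e = max ord ∈ [2, p-1]`) the
# registered residual at `p = 3` now reads: the valuation only ever meets END stages of the printed phase at DEGENERATE (corank ≥ 1) quadratic critical points of the line and
# then moves to the vertex / double line of the cone.  AND (hygiene, lead g9, folded in as the critic asked) the research stub `stub_cleanLU3DefectNonDiscrete` loses its binder `¬ (PerfectField k ∧ [Γ:pΓ] = p²)` (rev 26,
# THEOREM T), which is IMPLIED by the kept T⁗‴ binder (rev 32) under `hzd` — kernel certificate ✓ `Theorems/RadicialJungCleanModelsOfInputsPerfectPDegree.lean`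
# (`OfInputs.cleanLU3DefectNonDiscrete_rev34_of_rev33` / `…_rev33_of_rev34`: the two shapes are EQUIVALENT; κ_v is algebraic over k under `hzd`, hence perfect
# over a perfect k, and a perfect field has p-degree p⁰); `cleanLU3DefectNonDiscrete_of_stubs` keeps its `by_cases hT` (THEOREM T branch) and simply no longer
# passes `hT` to the stub; every other declaration byte-identical to rev 33; 7 sorries = 7 stubs.  The rev-33 composition is also available SORRY-FREE with the
# seven stubs as hypotheses: ✓ `Theorems/RadicialJungCleanModelsOfInputs.lean` (`OfInputs.cleanModels_of_inputs`, lead g9); rev 33 — TWO cuts.  (a) The `p = 2` SLICE OF THE WHOLE NODE `cleanLU3` RE-SOURCED to print: res-B-lens-5 g18/g19's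
# `Cruxes/DescentPerfectToAll/Lens5_PTwo_CP2019BaseSide.lean` rev 2 (crit TRIAGE-154/154b PASS), PORTED by the lead as `Theorems/…Lens5PTwo{Phase,Slice}.lean`:
# at `p = 2` the printed end state «multiplicity `< p`» of the base-side phase of Cossart–Piltant 2019 Thm. 1.5 (i) (INPUTS wi-91399,
# `Literature.AlgebraicGeometry.CossartPiltant200819.CossartPiltant2019_thm_1_5_i_baseSidePhase`) IS loose cleanness, so `cleanLU3_of_stubs` opens with
# `by_cases hp2 : p = 2` closed by ✓ `Lens5.PTwo.cleanLU3_of_eq_two_of_phaseTwo` over the NEW PRINTED STUB `stub_cp2019Thm15iBaseSidePhaseTwo` (the `p = 2`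
# instance of the fact, verbatim), and `cleanLU3Defect_of_stubs` / `cleanLU3DefectNonDiscrete_of_stubs` / `stub_cleanLU3DefectNonDiscrete` carry `p ≠ 2 →`
# (shape B of lens-5 g19's certified simulation); 7 sorries = 7 stubs (F-32 · F-02 · F-112 · CP base-side phase at 2 · class (B) · X44c · PRICE).
# (b) The research stub NARROWED by res-B-lens-5's THEOREMS T″/T‴ (g13/g14; crux workfiles `Lens5_TPrimeInf.lean` rev 3 +
# `Lens5_TPrimeInfCurrency.lean` rev 4 + `Lens5_TPrimeConst.lean` rev 1), PORTED def-free by the lead (g8) as `Theorems/…Lens5TFrame{SepCurrency,SepBridge,SepDeg,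
# GradedInf,TwoField1,TwoField2,TwoField3,ModelInf,Port4Inf,CompositionInf,SepConst}.lean`: over a ground field `k` of ARBITRARY (possibly infinite) `p`-rank,
# a zero-dimensional `O` with `[Γ:pΓ] = p²` such that, for SOME finite intermediate field of constants `k ⊆ k′ ⊆ K`, `K/k′` is separably generated and
# `κ_v/k′` is separable, is ✓ `Lens5TFrame.cleanLUConcl_of_sepConst ∘ cleanLU3DefectPRankTwoSepConst_of_cossartPiltant2019 ∘ cleanLU3DefectPRankTwoSepRes_of_cossartPiltant2019`
# modulo F-02 + F-32; one more `by_cases`, one more negative hypothesis in `stub_cleanLU3DefectNonDiscrete`; 6 sorries = 6 stubs unchanged in number.  With rev 32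
# the registered residual of class (B) is now EXACTLY lens-5's «{d(K|K^p, v) ≥ p²} ∪ (R3)» (CLASSB-map-lens5-g17.md): two independent immediate directions of the
# Frobenius extension at `v`, or infinite `p`-rank with `κ_v` inseparable / `K` not separably generated over every finite field of constants; rev 32 — the research stub NARROWED by res-B-lens-5's THEOREM T⁗‴ (valuation `p`-frames; g15, crux workfiles `Lens5_TFrame.lean` rev 4 +
# `Lens5_PDegreeCount.lean` rev 3), PORTED def-free by the lead (g8) as `Theorems/…Lens5TFrame{Currency,RG,IR,Graded,Port2,Port4Core,Layer,Layer2,Port4,Composition,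
# PMon,PDegreeA,PDegreeB,PDegreeC}.lean`: over ANY ground field `k` of FINITE `p`-rank `r` (no perfectness, no separability of `K/k` or of `κ_v/k`), a
# zero-dimensional `O` with `[Γ:pΓ] = p²` and `[κ_v : κ_v^p] = p^r` — i.e. the Frobenius extension `K/K^p` has MINIMAL defect `d(K|K^p, v) = p` at `v` —
# is ✓ `Lens5TFrame.cleanLU3DefectPRankTwoPDeg_of_pMon ∘ Lens5TFrame.cleanLU3DefectPRankTwoPMon_of_cossartPiltant2019` modulo F-02 + F-32; one more
# `by_cases` in `cleanLU3DefectNonDiscrete_of_stubs`, one more negative hypothesis in `stub_cleanLU3DefectNonDiscrete`; 6 sorries = 6 stubs unchanged in number.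
# What remains of class (B) (lens-5 CLASSB-map, crit TRIAGE-153): valuations with `d(K|K^p, v) ≥ p²` («two independent immediate directions») over grounds of
# finite `p`-rank, and infinite `p`-rank beyond the separable slices; rev 31 — ONE PRINTED INPUT FEWER: the named-fact stub `stub_cjs2020General` (F-78 `CossartJannsenSaito2020General`, resolution of
# excellent surfaces) is DROPPED.  Its only consumer, the (C-div) general divisorial theorem, used it to uniformize the finitely generated model
# `A[y₀, y₁]` along the composite valuation `O`; that is local uniformization of a 3-dimensional `k`-model, already a corollary of the skeleton's input
# F-02 `CossartPiltant2019` (✓ `CossartPiltant2019.lu3`, valuative criterion) — ✓ `Theorems/…CleanLU3CompositeCdivCP.lean`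
# (`cleanLU3Defect_of_divisorialCoarsening_cp (hEmb) (hCP : CossartPiltant2019)`, lead g8).  `cleanLU3DefectNonDiscrete_of_stubs` calls it with
# `stub_cossartPiltant2019`; 6 sorries = 6 stubs: THREE printed facts (F-32 `stub_cjs2020Thm14` · F-02 `stub_cossartPiltant2019` · F-112
# `stub_cossart1987Thm`) + the research residual `stub_cleanLU3DefectNonDiscrete` (class (B): rank-one non-discrete defect valuations) + `stub_cleanProp44`
# (X44c, res-B-princ3) + `stub_cleanModelsDimGEFour` (frontier); every other statement byte-identical to rev 30; rev 30 — the COMPOSITE case of the research residue KERNEL-CLOSED FOR EVERY GROUND FIELD, MODULO F-02 ONLY: ✓ `Theorems/…CcurveMainGen.lean`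
# (`Ccurve.cleanLU3Defect_of_properCoarsening (hCP : CossartPiltant2019)`; the perfectness needed by the unit case of the persist is replaced by Kuhlmann's
# generalized stability theorem on the residue valuation ring at the centre curve: ✓ `…CcurveUnitDefectless`, `…CcurveUnitDichotomy`, `…CcurvePersistForm2Gen`);
# the research stub is NARROWED by `¬ (∃ O₁, O ≤ O₁ ∧ O₁ ≠ O ∧ O₁ ≠ ⊤)` (it now concerns RANK-ONE valuations only); rev 29 — the (C-curve) SLICE of the research residue KERNEL-CLOSED MODULO F-02 ONLY (lead g6/g7 sub-line, workfile
# `Lines/Sketch_Ccurve_assembly.lean` v3.0 = 0 sorries): ✓ `Theorems/RadicialJungCleanModelsCcurveMain.lean` (`Ccurve.cleanLU3Defect_of_properCoarsening_perfect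
# (hCP : CossartPiltant2019)`: the COMPOSITE part of :249‴ over a PERFECT ground field — `O` zero-dimensional with a 3-dimensional regular f.g. centre, no divisorial
# coarsening, a PROPER coarsening `O₁` — via rebased D2 ✓, lift ✓, the geometric core `curveRegularize` ✓ (classical, F-32-free: ✓ `…CcurveRegFinal.lean`) and the
# closed-point persist by form ✓ `…CcurvePersistForm1/2/3.lean`); the research stub `stub_cleanLU3DefectNonDiscrete` is NARROWED further by
# `¬ (PerfectField k ∧ ∃ O₁, O ≤ O₁ ∧ O₁ ≠ O ∧ O₁ ≠ ⊤)` and `cleanLU3DefectNonDiscrete_of_stubs` gains one `by_cases`; NO new stub, 7 sorries = 7 stubs unchanged in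
# number; what remains of :249 off `k̄`: rank-one non-discrete valuations (class (B)) over perfect non-closed `k`, and imperfect `k`; rev 28 — stub 4e `stub_cleanPrincipalization3` RE-CUT along res-B-princ3's two LANDED kernel reductions (✓ p683310 X_perm ⟹ 4e,
# ✓ p684619 X44c ⟹ X_perm): the registered research stub of the patching branch is now `stub_cleanProp44` = X44c «CLEAN Cossart–Piltant 2008 Prop. 4.4 on
# clean stages» (the tree's PROVED `CossartPiltant2008_prop44` with clean-permissible centres), and 4e is a kernel NODE with its statement unchanged;
# 7 sorries = 7 stubs; rev 27 — the `k = k̄` SLICE of the research residue KERNEL-CLOSED modulo the printed theorem Cossart 1987 (F-112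
# `Literature.AlgebraicGeometry.Resolution.Cossart1987Thm`, ✓ p722151): res-B-lens-5 g11's anchor `Cruxes/DescentPerfectToAll/Lens5_KbarCossartAnchor.lean`
# (LEMMA G = read-off of Cossart's `ν = 0` along a `p`-basis, kernel; GLOBAL ⟹ along `v`, kernel) PORTED def-free by the lead (g6) to
# `Theorems/…Lens5KbarReadOff1/2`, `…Lens5KbarCossartPackaging`, `…Lens5KbarCossartGlobalToLocal`, `…Lens5KbarCossart` (consumer
# `Lens5.KbarCossart.cleanLU3DefectNonDiscrete_algClosed_of_cossart1987Thm`); printed stub F-112 `stub_cossart1987Thm` added; the research stub NARROWED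
# further by `¬ IsAlgClosed k` — 7 sorries = 7 stubs (4 printed facts F-32/F-78/F-02/F-112 + ONE research residual + princ3 + the frontier); rev 26 — the T-SLICE of res-B-lens-5 (THEOREM T: {PerfectField k, [Γ:pΓ]=p²}, mod F-02 + F-32) KERNEL-CLOSED and ported to
# `Theorems/…Lens5PRankTwoPort5.lean` ✓ p719465 (def-free corollary `Lens5.PRankTwoAssembly.cleanLU3DefectPRankTwo_of_cossartPiltant2019`; kits
# (i)–(vi) + Port1/2a/2b/3/4a/4b/Lattice/Lattice2 by res-B-cdiv-w1/w2/w4 and the lead); printed stub F-02 `stub_cossartPiltant2019` added; the research stub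
# NARROWED further by ¬(PerfectField k ∧ [Γ:pΓ]=p²) — 6 sorries = 6 stubs; rev 25 — the (C-div) SLICE of the defect residue KERNEL-CLOSED (✓ p715104 `Theorems/…CleanLU3CompositeCdiv.lean`, lead g5, with
# ✓ p709767 / ✓ p710978 / ✓ p711601 / ✓ p711640), `stub_cleanLU3DefectNonDiscrete` NARROWED to «no divisorial coarsening», printed stub F-78
# `stub_cjs2020General` added — 5 sorries = 5 stubs; rev 24 — the DIMENSION CUT, dim-3 slice OPENED along plan P2, F-75c LANDED, F-110 REFUTED and replaced by the
# honest stub `stub_cleanLU3`, the patching stub CUT into clean charts (✓ 4a) / clean two-model patching (✓ 4b) / glue (✓ 4c) /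
# clean point blow-up (✓ 4d) / CleanPrincipalization₃ (4e, research); rev 17: `stub_cleanLU3` CUT into the printed fact CJS Cor. 1.5 +
# the DEFECT residue `stub_cleanLU3Defect`, its defectless half LANDED ✓ p677129; rev 18: the residue restricted to ZERO-DIMENSIONAL
# NON-ABHYANKAR valuations — Abhyankar valuations LANDED ✓ via Kuhlmann's generalized stability theorem) for crux
# stmt-ResolutionOfSingularities-15917 `RadicialJung.CleanModels`

Line lead `res-B-lead-1` g0/g1/g2/g3 (prover, LINE-LEAD; director-resolution BLOCK 54 (A) + DR-IN2 (3), 2026-08-28/29).  Rev 24 (g3,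
2026-08-29 03:40Z) = rev 23 with class (A) cited by its canonical name ✓ `cleanLU3DefectArc_of_discrete`
(`Theorems/RadicialJungCleanModelsCleanLU3ArcDiscrete.lean`, the registrar's name of record).  Rev 23 (g3,
2026-08-29 03:30Z): **CLASS (A) IS CLOSED — for EVERY ground field, EVERY residue tower**: the two residual arc stubs of rev 22 are LANDED and
removed.  Seat res-B-lens-5 g7 (planner) wrote and farm-checked LEMMA D-abs (an ABSOLUTE derivation of `K` moving any non-`p`-th power `g₀` and
preserving `A` up to a denominator always exists: `p`-basis `∂_{g₀}` + LEMMA F₀ on denominators) and THEOREM P (a POTENTIAL argument along the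
quadratic sequence: given such a derivation and `O` discrete of rank one, the conclusion holds with NO residue hypothesis); the lead PORTED both
under `Theorems/` (✓ `…Lens5AbsDerivationF0`, ✓ `…Lens5AbsDerivation` = `Lens5.AbsDerivation.absDerivation_of_forall_pow_ne'` +
`stub_cleanLU3DefectArcConstants`, ✓ `…Lens5ArcPotentialBricks`, ✓ `…Lens5ArcPotentialCore`, ✓ `…Lens5ArcPotential` =
`Lens5.ArcPotentialProof.arcPotential` + `stub_cleanLU3DefectArcImperfect`).  `cleanLU3Defect_of_stubs` is now: discrete rank one ⟹ D-abs ⟹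
THEOREM P; otherwise `stub_cleanLU3DefectNonDiscrete`.  4 sorries: `stub_cjs2020Thm14` (printed, F-32) · `stub_cleanLU3DefectNonDiscrete` (classes
(B) rank one non-discrete / (C) composite; research) · `stub_cleanPrincipalization3` (research, seat res-B-princ3) · `stub_cleanModelsDimGEFour`
(frontier).  Rev 22 (g3,
2026-08-29 03:00Z): **CLASS (A) OVER A PERFECT GROUND FIELD IS CLOSED UNCONDITIONALLY** — ✓ `cleanLU3DefectArc_of_perfectField`
(`Theorems/RadicialJungCleanModelsCleanLU3ArcPerfect.lean`: rev-18 data + `PerfectField k` + discrete rank one ⟹ conclusion; the perfect-residue and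
derivation hypotheses of ✓ p688393 discharged by Zariski's lemma + `Algebra.IsAlgebraic.perfectField` and by ✓ p686805); `cleanLU3Defect_of_stubs`
splits on `PerfectField k` FIRST, so the two residual arc stubs now carry `¬ PerfectField k` explicitly: `stub_cleanLU3DefectArcConstants`
(imperfect `k`, no derivation moving `g₀`, `g₀ ∈ k[K^p]`) and `stub_cleanLU3DefectArcImperfect` (imperfect `k`, a derivation, not all residues
`p`-th powers, infinite tower).  6 sorries as in rev 21.  Rev 21 (g3,
2026-08-29 02:40Z): **CLASS (A) WITH PERFECT RESIDUE FIELDS IS LANDED FOR EVERY RESIDUE TOWER** — ✓ `cleanLU3Defect_of_discrete_of_perfectResidues`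
(`Theorems/RadicialJungCleanModelsCleanLU3ArcInfinite.lean`, over ✓ `arc_infinite_core` = `…ArcCoreOrder` + `…ArcCoreFinal`, and the
infrastructure `…ArcQConst` (Q-constants = algebraic Teichmüller digits), `…ArcRep`, `…ArcTower`, `…ArcTaylor`, `…ArcApprox`, `…ArcCorePrelims`,
`…ArcWrapPrelims`): res-B-lens-5 g6's hand proof §7 made algebraic and kernel-checked.  The former stub `stub_cleanLU3DefectArcInfinite` is
thereby CUT into the landed theorem + the residual `stub_cleanLU3DefectArcImperfect` (discrete rank one, a derivation moving `g₀`, but SOME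
intermediate ring with a residue that is not a `p`-th power AND an infinite residue tower — needs an IMPERFECT ground field); the corner
`stub_cleanLU3DefectArcConstants` becomes «NO derivation of `K` moving `g₀` preserves `A` up to a denominator» (hence `g₀ ∈ k[K^p]` by the LANDED
✓ p686805 `stub_derivation_of_not_mem_adjoin_pow`, seat res-B-deriv-w1; only possible for `K/k` inseparable) with no residue-tower hypothesis.  6 sorries: `stub_cjs2020Thm14` (printed) · `stub_cleanLU3DefectArcConstants` ·
`stub_cleanLU3DefectArcImperfect` · `stub_cleanLU3DefectNonDiscrete` (classes (B)/(C)) · `stub_cleanPrincipalization3` · `stub_cleanModelsDimGEFour`.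
Rev 20 (g3,
2026-08-29 01:15Z): the research residue `stub_cleanLU3Defect` is CUT by valuation class, and its «arc» class with a FINITE RESIDUE TOWER is
LANDED: ✓ `cleanLU3Defect_of_discrete_of_finiteResidue` (`Theorems/RadicialJungCleanModelsCleanLU3ArcDischarge.lean`, over ✓ p681465
`arc_core` + ✓ p683623 `…ArcPackage`) settles every zero-dimensional DISCRETE RANK-ONE valuation whose residue field is finitely generated
over that of the centre, given a derivation of `K` moving `g₀` and preserving `A` up to a denominator (ALL of class (A) over an
algebraically closed ground field).  What remains of `stub_cleanLU3Defect` is registered as FOUR stubs: `stub_cleanLU3DefectArcInfinite`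
(discrete rank one, residue field NOT finitely generated over the centre's — infinite residue towers; research, an algebraic route via
truncated Teichmüller coefficient fields is in the lead's notes), `stub_derivation_of_not_mem_adjoin_pow` (field theory, M, DELEGABLE:
`g₀ ∉ k[K^p]` ⟹ a `k`-derivation moving `g₀`, via `p`-bases and dual derivations) + `stub_cleanLU3DefectArcConstants` (discrete, finite
residue tower, `g₀ ∈ k K^p`: vacuous over perfect `k`; the infinite-`p`-rank / inseparable-constant-extension corner),
`stub_cleanLU3DefectNonDiscrete` (classes (B) rank one non-discrete and (C) composite: `O` admits no value-generator `π`; research, Cossart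
1987-type).  Composition `cleanLU3Defect_of_stubs` by excluded middle; 7 sorries: `stub_cjs2020Thm14` (printed) · the four residue stubs ·
`stub_cleanPrincipalization3` (research, seat res-B-princ3) · `stub_cleanModelsDimGEFour` (frontier).  Rev 19 (g3,
2026-08-29 00:35Z) = rev 18a ADOPTED (rev 18a was proposed by seat `res-B-bridge-cor15` g0 as `Lines/Sketch_rev18a_cjs2020Cor15.lean`):
the printed stub `stub_cjs2020Cor15` (CJS Cor. 1.5) is PROVED from the keyed named fact CJS Thm. 1.4 (`B = ∅`)
`CossartJannsenSaito2020Embedded` by ✓ p681514 `stub_cjs2020Cor15_of_embedded`; the named-fact stub becomes `stub_cjs2020Thm14` (F-32).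
4 sorries: `stub_cjs2020Thm14` (printed, keyed F-32) · `stub_cleanLU3Defect` (research) · `stub_cleanPrincipalization3` (research) ·
`stub_cleanModelsDimGEFour` (frontier); everything else byte-identical to rev 18.  Rev 18 (g2,
2026-08-29 01:30Z): the research residue `stub_cleanLU3Defect` is SHRUNK twice more, by landed theorems: (i) it is asked only at
ZERO-DIMENSIONAL valuation rings (all centres above `A` closed points) — the landed 4a variant `cleanCharts3_of_cleanLU3ZeroDim`
(p679469) consumes exactly that; (ii) it is asked only at valuations WITH transcendence defect (`rat.rk + res.tr.deg < 3`, i.e. NOT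
Abhyankar): at Abhyankar valuations `(K, O)` is a defectless field by Kuhlmann's generalized stability theorem (PROVED in the tree,
`Kuhlmann2010Stability_holds`), a defectless purely inseparable extension of height one admits best approximations (✓ p678804 /
p679197, valuation-independent basis), so `g₀` HAS a best `p`-th-power approximation and the defectless half applies
(`cleanLU3_of_transcendenceDefect_eq_zero`, `Theorems/RadicialJungCleanModelsCleanLU3Abhyankar.lean`).  4 sorries as in rev 17.  Rev 17 (g2,
2026-08-28 23:30Z): the honest open stub `stub_cleanLU3` (clean local uniformization at 3-dimensional centres) is CUT along the
valuation-theoretic dichotomy «does `g₀` admit a best `p`-th-power approximation for `v`?»: YES (the `K^p`-line of `g₀` is DEFECTLESS at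
`v`: ramified or inert) is LANDED as `cleanLU3_of_isMin_pthPowerApprox` (✓ p677129, `Theorems/RadicialJungCleanModelsCleanLU3Defectless.lean`:
monomialize the remainder `g₀ - f₀^p` along `v` by embedded resolution of surfaces and read cleanness off, ✓ p674982/p675489) modulo the
PRINTED fact CJS 2020 Cor. 1.5, now the registered named-fact stub `stub_cjs2020Cor15` (the standing hypothesis `hEmb` of
`Literature/…/MonomializationAlongValuation.lean`); NO (every approximation can be strictly improved: the line is IMMEDIATE at `v` — defect
`p`) is the registered research residue `stub_cleanLU3Defect` (= `stub_cleanLU3` + that hypothesis; the cleaning step ✓ `cleanLU3_or_exists_lt`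
shows it is exactly the valuations carrying an INFINITE strictly improving sequence of approximations, and ✓ `cleanLU3_of_wellFounded_approx`
settles every valuation where improvement is well-founded, e.g. discrete rank one with `g₀` not a `v`-limit of `p`-th powers).  4 sorries =
`stub_cjs2020Cor15` (printed) + `stub_cleanLU3Defect` (research) + `stub_cleanPrincipalization3` (research) + `stub_cleanModelsDimGEFour`
(frontier).  Rev 13.2 (g1):
`stub_stacks0BICLocus` is LANDED by name (F-75c discharged, p661545; stub p661999) and is used from the import;
`stub_cp2019Thm15iFrame` is RE-POINTED BY NAME to the landed Literature definition F-110
`Literature.AlgebraicGeometry.CossartPiltant200819.CossartPiltant2019_thm_1_5_i_frame.{0}` (p660730; its body is the rev-13.1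
stub statement verbatim at universe 0, `rfl`-certified below).  Rev 14 (g1, same day): the XL stub `stub_cleanPatching3` is
CUT into five registered stubs (section «The former stub `stub_cleanPatching3`» below; predicates `CleanRegAt` /
`ModelCleanRegAt` landed as `Theorems/RadicialJungCleanModelsCleanPatchingDefs.lean`, p666391), composed by
`cleanPatching3_of_stubs`; the file has 7 sorries = the named fact F-110 + 5 OURS stubs (4a–4e, 4e the research residue)
+ `stub_cleanModelsDimGEFour` (frontier, 0 prover-hours).  Rev 15 (g1, same evening): F-110 is FALSE AS TYPED (crit-1 VERDICT (β)
20:54Z) ⇒ `stub_cp2019Thm15iFrame` REMOVED, `CleanLU3` carried as the honest open stub `stub_cleanLU3` (signature = 4a's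
hypothesis); 4a `stub_cleanCharts3` LANDED (✓ p669538) and used by name; 6 sorries = `stub_cleanLU3` (OPEN, re-source) + 4b +
4c + 4d + 4e (research) + `stub_cleanModelsDimGEFour` (frontier).  Rev 16 (g1, 2026-08-28 22:10Z): THREE MORE STUBS LANDED and are used
by name — the glue 4c `stub_cleanGlobalization3` (lead, ✓ p672722, Zariski globalization relative to `W`; helpers ✓ p669696 …
✓ p671597), 4b `stub_cleanTwoModelPatching3` (✓ p671093, seat deleg-15917-cleanCharts3-g0) and 4d `stub_cleanPointBlowup` (✓ p671162,
seat deleg-15917-cleanPointBlowup-g0); 3 sorries = `stub_cleanLU3` (OPEN, re-source) + 4e `stub_cleanPrincipalization3` (research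
residue) + `stub_cleanModelsDimGEFour` (frontier, no prover-hour).  Rev 11 cut the crux
by dimension (`stub_stacks0BICLocus` / `stub_cleanModelsDimThree` / `stub_cleanModelsDimGEFour`).  Rev 12/13 keep that cut and
OPEN the dim-3 slice (rev 13, same day: `CleanLU3` is asked only at centres whose local ring has dimension 3 — Cossart–Piltant's
own (LU) hypothesis in Prop 4.6 «for every local ring … which is of dimension three»; valuations with lower-dimensional centre
are the patching stub's business, via refinement to a closed centre + GENERISATION of loose cleanness, landed as
`RadicialJungCleanModelsGenerisation.lean` — and with this cut `stub_cleanLU3_of_frame` is CLOSED by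
`cleanLU_of_frame_of_dimThreeCentre`, p659057; rev 13.1 imports the landed stub p659322, so the file has 4 sorries = the 4 open stubs) along plan P2 of the card `Cruxes/DescentPerfectToAll/Lines/via-clean-models.md` (rev 2c), now that its
inputs are kernel-checked: lemma L1 and its monogenic/frame forms (p655975, p657241, p657882:
`clean_shift_of_adjoinRoot_regular` — `S[X]/(X^p - f)` regular local ⟹ `f - c^p` clean) and the pointwise reduction
`cleanModelsDimThree_of_logCleanPrincipalizationDimThree` (p657305).  The dim-3 slice becomes THREE registered stubs:

* `stub_cp2019Thm15iFrame` — **the consumer shape of INPUTS row F-CP15-frame** («Cossart–Piltant 2019 Thm 1.5 (i) in the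
  (S,h,E)-frame», J. Algebra 529, Thm 1.5 (i) p. 271–272 with Prop 2.22 p. 294 and its proof's formula in case (i):
  `h' = X'^p + f'`, `f' = u^{-p}(f + θ^p)`), BASE-SIDE TOWER FORM in the vocabulary of `Literature/…/Resolution/LocalBlowup.lean`
  (`locAtCentre`, `IsLocalBlowupAlong`): for `S` excellent regular local of dimension 3 and characteristic `p`, `f ∈ S` not a
  `p`-th power in `K = Frac S`, and a valuation ring `O` of `K` dominating `S` (valuations of `L = K(f^{1/p})` centred in `𝔪_S`
  ↔ valuations of `K` centred in `𝔪_S`, `L/K` being radicial), there is a finite tower `S = B₀ ≤ B₁ ≤ ⋯ ≤ B_n ≤ O` of REGULAR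
  local subrings of `K`, each `B_{i+1}` the local blowing up of `B_i` w.r.t. `O` along an ideal `P_i` with `B_i/P_i` regular (a
  centre with normal crossings, Def 2.21 / E = ∅), elements `g_i ∈ B_i`, `g₀ = f`, `g_{i+1} = c^p g_i + d^p` (`c ≠ 0`; the
  printed `u^{-p}(g_i + θ^p)`), such that the radicial cover `B_n[X]/(X^p - g_n)` (= the germ `(𝒳_n, x_n)`, a LOCAL ring) is a
  regular local ring.  The sign convention `h = X^p - g` (ours) replaces the printed `X^p + f` (`f = -g`).  To be TYPED by an
  INPUTS typer as `Literature/AlgebraicGeometry/CossartPiltant200819/Thm15FrameSHE2019.lean` keyed by THIS signature (DR-IN2);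
  it is a printed theorem (composite of Thm 1.5 (i) + Prop 2.22), so the stub will be carried as a named-fact hypothesis.
* `stub_cleanLU3_of_frame` — OURS (size M; PROVED as `cleanLU_of_frame_of_dimThreeCentre`, p659057, landing as the stub next): the
  frame ⟹ CLEAN LOCAL UNIFORMIZATION at 3-dimensional centres (`CleanLU3`, the affine-model form of
  `Literature.….LocalUniformization3` with loose cleanness of the `K^p`-line of `g₀` at the centre added, asked where the local
  ring of the regular model at the centre has dimension 3): frame applied to `S = A_{𝔪_O ∩ A}` + tower-to-model bookkeeping
  (`exists_eq_locAtCentre_of_reflTransGen`) + `clean_shift_of_adjoinRoot_regular` + the `K^p`-line induction `g_n = C^p f + D^p`.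
* (rev ≤ 13) `stub_cleanPatching3` — OURS, NOT IN PRINT as such (size XL): **patching for clean pairs in dimension 3**,
  `CleanLU3 p → LogCleanPrincipalization₃ p`.  Rev 14 CUTS it (see the section below) into `stub_cleanCharts3` (4a),
  `stub_cleanTwoModelPatching3` (4b), `stub_cleanGlobalization3` (4c), `stub_cleanPointBlowup` (4d),
  `stub_cleanPrincipalization3` (4e = the research residue: Cossart–Piltant Prop. 4.4 keeping cleanness), composed by
  `cleanPatching3_of_stubs` — Zariski–Piltant patching for `P_clean`, transferred from the tree's proved `P_reg` chain.
* LANDED: `stub_stacks0BICLocus` (F-75c discharged p661545; stub p661999).  Unchanged: `stub_cleanModelsDimGEFour` (frontier; no prover-hour).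
* `CleanModels_of` — the crux BY NAME: `dim ≤ 2` by `cleanModels_dimLETwo_of_f75c` (p578792) fed with the landed F-75c;
  `dim 3` by `cleanModelsDimThree_of_logCleanPrincipalizationDimThree (cleanPatching3_of_stubs (stub_cleanLU3_of_frame F-110))`;
  `dim ≥ 4` by the frontier stub.

Honest framing: nothing here proves resolution in characteristic `p`; `CleanModels` in `dim ≥ 3` is unsettled; the dim-3 slice
is printed-ADJACENT (its local half is Cossart–Piltant's theorem, its global half is not in print).
-/

noncomputable section

set_option linter.dupNamespace false

open CategoryTheory AlgebraicGeometry
open Literature.AlgebraicGeometry.Resolution Literature.AlgebraicGeometry.Motives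

namespace Summit.ResolutionOfSingularities.ResolutionOfSingularities.Theorems.RadicialJung.CleanModels

-- STUB 1 `stub_stacks0BICLocus` is LANDED (p661999, `Theorems/RadicialJungCleanModelsStubStacks0BICLocus.lean`, FQN
-- `Summit.ResolutionOfSingularities.ResolutionOfSingularities.Theorems.stub_stacks0BICLocus`; F-75c itself is the THEOREM
-- `stacks0BIC_embeddedResolutionCurvesInSurfaces_locus_holds`, p661545): used below BY NAME from the import.

/-- STUB (NAMED PRINTED FACT — hand-1 reshape candidate, 2026-08-30): **Cossart–Piltant 2019, Thm. 1.1 VERBATIM with (i)(ii)(iii)**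
(«`𝒳'` everywhere regular; `π` an isomorphism over `Reg 𝒳`; `π⁻¹(Sing 𝒳)` a strict normal crossings divisor») = the keyed Literature
named fact `Literature.AlgebraicGeometry.CossartPiltant200819.CP2019.CossartPiltant2019Thm11` (`GoodResolution2019.lean:116`) at universe `0`.
It REPLACES the former printed stubs `stub_cjs2020Thm14` (F-32, CJS 2020 Thm. 1.4) — every use of which in the dim-3 slice was the `hEmb`
shape for a hypersurface `V(x) ⊂ Spec R`, now DERIVED from Thm. 1.1 (iii) by the doubling trick (✓ `Doubling.hEmb_zeroLocus_of_thm11`,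
✓ `exists_localRing_monomial_of_thm11_dim` and the `_thm11` re-threadings) — and `stub_cossartPiltant2019` (F-02, now DERIVED below).
[cite: CossartPiltant2019, Thm. 1.1] -/
theorem stub_cp2019Thm11 : Literature.AlgebraicGeometry.CossartPiltant200819.CP2019.CossartPiltant2019Thm11.{0} := by
  sorry


-- Rev 31: the former STUB 2a″ `stub_cjs2020General` (NAMED PRINTED FACT F-78 `CossartJannsenSaito2020General`, rev 25–30: resolution of excellent
-- surfaces, Cossart–Jannsen–Saito 2020 Thm. 1.2) is DROPPED — its one use (a regular model of `A[y₀, y₁]` along the composite valuation in the (C-div)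
-- general divisorial theorem) is served by F-02 `stub_cossartPiltant2019` through ✓ `cleanLU3Defect_of_divisorialCoarsening_cp`
-- (`Theorems/RadicialJungCleanModelsCleanLU3CompositeCdivCP.lean`).

/-- STUB 2a‴ (NAMED PRINTED FACT, rev 26): **resolution of singularities of threefolds in positive characteristic** — Cossart–Piltant 2019 (J. Algebra 529),
Thm. 1.1 / its local-uniformization leaf `LocalUniformization3`, = the keyed Literature named fact `Literature.AlgebraicGeometry.Resolution.CossartPiltant2019`
(FACT-LIST F-02) at universe `0`.  Input of the T-slice ✓ `Lens5.PRankTwoAssembly.cleanLU3DefectPRankTwo_of_cossartPiltant2019` (res-B-lens-5's THEOREM T,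
ported: local uniformization of the Frobenius-twist threefold `k·K^p(g₀)`), of the (C-curve)/composite slice ✓ `Ccurve.cleanLU3Defect_of_properCoarsening`
(rev 29/30) and — rev 31 — of the (C-div) slice ✓ `cleanLU3Defect_of_divisorialCoarsening_cp` (local uniformization of the model `A[y₀, y₁]` along `O`,
formerly F-78).  [cite: CossartPiltant2019, Thm. 1.1] -/
theorem stub_cossartPiltant2019 : CossartPiltant2019.{0} :=
  Literature.AlgebraicGeometry.CossartPiltant200819.CP2019.CossartPiltant2019Thm11.cossartPiltant2019 stub_cp2019Thm11
    Stacks07QW_field_holds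

/-- STUB (PRINTED INPUT, rev 36″; replaces F-112 `stub_cossart1987Thm` of rev 27–35) — **Cossart 1987 for a RATIONAL function = Posva 2024 Claim 5.1.2**
(Q. Posva, arXiv:2405.05735 (2024), Claim 5.1.2 p. 26 and App. A §A.7 pp. 38–39, «a slight generalization of the main result of Cossart's thesis [Cos87b]»:
for `X` a regular quasi-projective threefold over an ALGEBRAICALLY CLOSED field `k` of characteristic `p` and `u ∈ K(X) ∖ K(X)^p`, a projective birational
`V → X` with `V` regular such that at EVERY point some `u v^p` has Cossart's `ν = 0`) — the keyed Literature definition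
`Literature.AlgebraicGeometry.Resolution.Cossart1987ThmRational` (`Literature/AlgebraicGeometry/Resolution/CossartFunctionNormalForm3.lean`, ✓ p836473, reviewed
against the held arXiv text; primary [Cossart1987]/[Cos87b] NOT held, acq-14300 / acq-14301 open).  A printed theorem carried as a named-fact hypothesis; consumed by
✓ `KbarRational.cleanLU3DefectNonDiscrete_algClosed_of_cossartRational` (the `k = k̄` slice of the research stub below) AND — rev 36″ — by the top-level
`by_cases IsAlgClosed k` of `CleanModels_of` through ✓ `KbarQuasiProjective.cleanModels_algClosed_dimLEThree_of_cossartRational` (the whole dim-`≤ 3` slice over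
`k̄`, every `W`, no LU, no patching). [cite: Posva2024, Claim 5.1.2 and App. A §A.7] [cite: Cossart1987, main theorem] -/
theorem stub_cossart1987ThmRational : Cossart1987ThmRational := by
  sorry

/-!
## The former stub `stub_cleanLU3Defect` (rev 17/18), CUT by valuation class (rev 20)

It read: **`CleanLU3` at ZERO-DIMENSIONAL NON-ABHYANKAR valuations where the line of `g₀` is IMMEDIATE** — the statement of the former
`stub_cleanLU3` (clean local uniformization at a 3-dimensional regular centre: some finitely generated `A ≤ A' ⊆ O`, regular at the centre of
`O`, carries there a loosely clean non-trivial representative of the `K^p`-line of `g₀`) under the EXTRA hypotheses `hdefect` (rev 17: `g₀`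
has NO best `p`-th-power approximation for `v = v_O` — the line `K(g₀^{1/p})/K` is immediate at `v`, CP 2019 Remark 4.11), `hzd` (rev 18:
every centre of `O` above `A` is a closed point) and `htd` (rev 18: transcendence defect `≠ 0`, not Abhyankar — Abhyankar valuations are
settled by ✓ `cleanLU3_of_transcendenceDefect_eq_zero` via Kuhlmann ✓).  Its class list (memo `Lines/Sketch-memo-defect-residue.md`):
(A) arcs = discrete rank one (`g₀` a `v`-adic limit of `p`-th powers), (B) rank one NOT discrete, (C) composite.  Rev 20: class (A)
with a FINITE residue tower (and a derivation of `K` moving `g₀`) is LANDED — ✓ `cleanLU3Defect_of_discrete_of_finiteResidue` over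
✓ `arc_core`; rev 23: ALL of class (A) is LANDED (LEMMA D-abs + THEOREM P, res-B-lens-5 g7, ported by the lead), the one stub below —
classes (B)/(C) — is what remains, and `cleanLU3Defect_of_stubs` recomposes the rev-18 statement by excluded middle.
Nearest print for (B)/(C): Cossart 1987 «Forme normale d'une fonction sur un k-schéma de dimension 3…» (Travaux en Cours 22, acq-14300) /
Cossart's thèse d'État 1987 (acq-14301) / Moh 1996 (La Rábida, Progress in Math. 134, pp. 80–88), all for `k = k̄`; the statements here
are for every ground field.
-/

-- Rev 23: class (A) (discrete rank one) is LANDED in full — ✓ `Lens5.AbsDerivation.absDerivation_of_forall_pow_ne'` (LEMMA D-abs) and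
-- ✓ `Lens5.ArcPotentialProof.arcPotential` (THEOREM P), both by res-B-lens-5 g7, ported by the lead; the former arc stubs
-- `stub_cleanLU3DefectArcInfinite` / `…ArcImperfect` / `…ArcConstants` and the special cases ✓ `cleanLU3Defect_of_discrete_of_finiteResidue`,
-- ✓ `cleanLU3Defect_of_discrete_of_perfectResidues`, ✓ `cleanLU3DefectArc_of_perfectField` are all superseded by it and no longer used here.

/-- STUB (PRINTED INPUT, `p = 2` INSTANCE ONLY, rev 33): **Cossart–Piltant 2019, Thm. 1.5 (i), the multiplicity-`p` phase read base-side, AT `p = 2`** —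
the `p = 2` instance, VERBATIM, of the typed printed theorem `Literature.AlgebraicGeometry.CossartPiltant200819.CossartPiltant2019_thm_1_5_i_baseSidePhase`
(`Thm15iBaseSidePhase2019.lean`, INPUTS wi-91399; = the type of ✓ `Lens5.PTwo.baseSidePhaseTwo_of_cp2019 : CossartPiltant2019_thm_1_5_i_baseSidePhase.{0} → ‹this›`):
for `S` excellent regular local of dimension `3` and characteristic `2`, `f ∈ S` not a square in `K = Frac S`, and `O` a valuation ring of `K` dominating `S`,
a finite tower of regular local rings `S = B 0, …, B n ⊆ O` (local blowing ups at the centres of `O` along ideals `P` with `B i ⧸ P` regular) with radicands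
`g (i+1) = c² g i + d²`, `c ≠ 0`, ending with `g n - c² ∉ 𝔪_{B n}²` for every `c ∈ B n` (multiplicity `< 2`).  Consumed by ✓ `Lens5.PTwo.cleanLU3_of_eq_two_of_phaseTwo`
(`Theorems/RadicialJungCleanModelsLens5PTwoSlice.lean`, res-B-lens-5 g18, ported): at `p = 2` the WHOLE node `cleanLU3_of_stubs` (every valuation ring, every
ground field of characteristic `2`) follows from this stub ALONE — F-32 / F-02 / F-112 and the research stub are not touched at `p = 2`.  A printed theorem
carried as a named-fact hypothesis (typed through the structure of the printed proof — Cor. 5.6 = Cor. 4.19 + Thm. 2.81 + Thm. 5.5, Prop. 2.22; the sibling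
over-read F-110 with END «regular» is REFUTED, this END «multiplicity `< p`» is strictly weaker).
[cite: CossartPiltant2019, Thm. 1.5 (i) pp. 271–272; Cor. 5.6 p. 405; Prop. 2.22 with (2.17)/(2.18) pp. 294–295; Thm. 2.81 p. 341; Cor. 4.19 p. 402; Thm. 5.5 p. 405] -/
theorem stub_cp2019Thm15iBaseSidePhaseTwo :
    ∀ (S : Type) [CommRing S] [IsRegularLocalRing S],
      IsExcellentRing S → ringKrullDim S = 3 → CharP S 2 →
      ∀ (K : Type) [Field K] [Algebra S K] [IsFractionRing S K] (f : S),
      (∀ c : K, c ^ 2 ≠ algebraMap S K f) →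
      ∀ (O : ValuationSubring K), (algebraMap S K).range ≤ O.toSubring →
      (∀ s ∈ IsLocalRing.maximalIdeal S, O.valuation (algebraMap S K s) < 1) →
      ∃ (n : ℕ) (B : ℕ → Subring K) (g : ℕ → K),
      B 0 = locAtCentre (algebraMap S K).range O ∧ g 0 = algebraMap S K f ∧
      (∀ i ≤ n, B i ≤ O.toSubring ∧ IsRegularLocalRing (B i) ∧ g i ∈ B i) ∧
      (∀ i < n, ∃ P : Ideal (B i), IsRegularLocalRing ((B i) ⧸ P) ∧
        IsLocalBlowupAlong O (B i) P (B (i + 1)) ∧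
        ∃ c d : K, c ≠ 0 ∧ g (i + 1) = c ^ 2 * g i + d ^ 2) ∧
      ∀ (hg : g n ∈ B n) (_hBn : IsRegularLocalRing (B n)) (c : B n),
        (⟨g n, hg⟩ : B n) - c ^ 2 ∉ IsLocalRing.maximalIdeal (B n) ^ 2 := by
  sorry

/-- STUB 2b-B (OURS, RESEARCH, rev 35 = rev 34 with the MORSE binder GENERALISED to the SMOOTH-CONE binder of the lead g10 — PLUS the hypothesis «no finitely generated
model along `O`, regular at the centre, carries a representative `h ≡ F(t) (mod 𝔪^{e+1})` of the line, `F` homogeneous of degree `e` prime to `p`, whose projectivised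
tangent cone is SMOOTH (Jacobian form)» (those valuations are ✓ `ConeExit.cleanLUConcl_of_smoothCone`: one quadratic transform, form (1), every valuation; the
`e = 2` instances are rev 34's Morse stages, ✓ `ConeExit.cleanLUConcl_of_nondegenerate`) — and WITHOUT the binder `¬ (PerfectField k ∧ [Γ:pΓ] = p²)` — redundant: implied by the T⁗‴ binder under `hzd`,
kernel certificate ✓ `OfInputs.cleanLU3DefectNonDiscrete_rev34_of_rev33`; the statement is EQUIVALENT to rev 33's.  Rev 33 text: rev 33 = rev 32 with `p ≠ 2` (the `p = 2` slice is the printed stub above) and NARROWED by the ported THEOREMS T″/T‴ of res-B-lens-5): PLUS the hypothesis «NOT ([Γ:pΓ] = p² ∧ for some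
finite intermediate field `k ⊆ k′ ⊆ K`: `K/k′` separably generated ∧ `κ_v/k′` separable for a compatible `k′`-algebra structure on `κ_v`)» — those valuations
(grounds of ARBITRARY `p`-rank) are ✓ `Lens5TFrame.cleanLUConcl_of_sepConst ∘ cleanLU3DefectPRankTwoSepConst_of_cossartPiltant2019 ∘ cleanLU3DefectPRankTwoSepRes_of_cossartPiltant2019`
(F-02 + F-32).  The registered residual is now lens-5's «{d(K|K^p, v) ≥ p²} ∪ (R3)» exactly.  Rev 32 text: STUB 2b-B (rev 32 = rev 30/31 NARROWED by the ported THEOREM T⁗‴ of res-B-lens-5): PLUS the hypothesis «NOT ([Γ:pΓ] = p² ∧ ∃ r,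
[k : k^p] = p^r ∧ [κ_v : κ_v^p] = p^r)» (the two `p`-degrees as `Module.finrank` over the subfields generated by `p`-th powers) — over a ground field of
finite `p`-rank the MINIMAL-DEFECT valuations (`d(K|K^p, v) = p`) are ✓ `Lens5TFrame.cleanLU3DefectPRankTwoPDeg_of_pMon ∘ …PMon_of_cossartPiltant2019`
(F-02 + F-32).  What remains: rank-one non-discrete `O` with `d(K|K^p, v) ≥ p²` (over perfect `k`: `[Γ:pΓ] ≤ p`, `k ≠ k̄`; over imperfect `k` of finite
`p`-rank: `[Γ:pΓ] ≤ p` or `[κ_v : κ_v^p] < [k : k^p]`), and grounds of infinite `p`-rank.  Rev 30 text: STUB 2b-B (rev 30 = rev 29 with the composite case closed for EVERY field): the hypothesis is now `¬ (∃ O₁, O ≤ O₁ ∧ O₁ ≠ O ∧ O₁ ≠ ⊤)` —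
`O` has RANK ONE; the composite case is ✓ `Ccurve.cleanLU3Defect_of_properCoarsening` (any `k`, mod F-02 only).  What remains: rank-one non-discrete `O`
(class (B)), over perfect non-closed `k` with `[Γ:pΓ] ≤ p`, and over imperfect `k`.  Rev 29 text:
STUB 2b-BC⁗ (OURS, RESEARCH, rev 29 = rev 27 NARROWED by the KERNEL-CLOSED (C-curve) slice): as in rev 27 (below), PLUS the hypothesis
`¬ (PerfectField k ∧ ∃ O₁, O ≤ O₁ ∧ O₁ ≠ O ∧ O₁ ≠ ⊤)` — over a PERFECT ground field, a zero-dimensional `O` (3-dimensional regular f.g. centre, no divisorial coarsening)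
WITH a proper coarsening `O₁` (composite, class (C-curve)) is ✓ `Ccurve.cleanLU3Defect_of_properCoarsening_perfect` modulo F-02 `stub_cossartPiltant2019` ONLY
(lead g6/g7: rebased D2 + lift + classical F-32-free `curveRegularize` + persist by form).  What remains: {`k` perfect, not algebraically closed, `O` of RANK ONE
(no proper coarsening), not discrete, `[Γ:pΓ] ≤ p` — class (B)} ∪ {imperfect `k`}, both OPEN IN PRINT (F-eq / F-abs).  Rev 27 text:
STUB 2b-BC‴ (OURS, RESEARCH, rev 27 = rev 26 NARROWED by the KERNEL-CLOSED `k = k̄` slice): as in rev 26 (below), PLUS the hypothesis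
`¬ IsAlgClosed k` — over an algebraically closed ground field the statement (indeed the whole node `cleanLU3_of_stubs`, every valuation class) is
✓ `Lens5.KbarCossart.cleanLU3DefectNonDiscrete_algClosed_of_cossart1987Thm` modulo the printed theorem F-112 `stub_cossart1987Thm` (res-B-lens-5 g11's
anchor: Cossart's `ν = 0` along `v` + LEMMA G, ported by the lead).  What remains (the round's honest end state of the dim-3 research residue):
{`k` perfect, NOT algebraically closed, `[Γ:pΓ] ≤ p` — missing input «Gal(k̄/k)-stable Cossart centres along `v`» (F-eq), printed obstruction
Posva Rem. 5.1.8 / [Cos87b] II.C.5.4} ∪ {imperfect `k` — absolute-derivation form F-abs}, both OPEN IN PRINT.  Rev 26 text: as rev 25, PLUS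
`¬(PerfectField k ∧ [Γ:pΓ] = p²)` (THEOREM T of res-B-lens-5, ✓ `Lens5.PRankTwoAssembly.cleanLU3DefectPRankTwo_of_cossartPiltant2019`, mod F-02 + F-32).
Rev 25 text: STUB 2b-BC′ (OURS, RESEARCH, rev 25 = rev 20 NARROWED by the KERNEL-CLOSED (C-div) slice): as before, PLUS the hypothesis that `O` has NO
DIVISORIAL COARSENING — no valuation ring `O ≤ O₁ ≠ K` with two elements of `O` whose residues in `κ(O₁)` are algebraically independent over
`k` (composite valuations whose first component is divisorial are ✓ `cleanLU3Defect_of_divisorialCoarsening`, mod F-32 + F-78).  What remains: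
rank one non-discrete (class (B): rational rank 1 with `Γ ⊂ ℚ` not discrete, or rational rank 2), and composite valuations whose proper
coarsenings all have residue transcendence degree `≤ 1` (class (C-curve)); on the slice `[Γ:pΓ] = p²` over perfect `k` the T-slice of
res-B-lens-5 (THEOREM T, `Cruxes/DescentPerfectToAll/Lens5_PRankTwoAssembly.lean`, mod F-02 + F-32) is the next closure candidate.
Original rev-20 text: STUB 2b-BC (OURS, RESEARCH, rev 20): **classes (B) and (C)** — the rev-18 statement of `stub_cleanLU3Defect` at a zero-dimensional
non-Abhyankar `O` which is NOT discrete of rank one in the above sense (no `π ≠ 0` whose value bounds every value `< 1` with powers going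
below every value): rank one of rational rank `1` non-discrete or of rational rank `2` (class (B): inside it «values `v(g₀ - f^p)` unbounded»
is the natural target of the window idea, «bounded, not attained» is genuine Kuhlmann defect), and the composite zero-dimensional valuations
of rank `2, 3` with rational rank `≤ 2` (class (C)).  Nearest print: Cossart 1987 (acq-14300/14301), Moh 1996, all for `k = k̄`. [folklore] -/
theorem stub_cleanLU3DefectNonDiscrete :
    ∀ (p : ℕ), p.Prime → p ≠ 2 →
    ∀ (k : Type) [Field k] [CharP k p] (K : Type) [Field K] [Algebra k K]
    (O : ValuationSubring K) (A : Subalgebra k K), A.toSubring ≤ O.toSubring → A.FG → IsFractionRing A K →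
    ringKrullDim A ≤ 3 → IsRegularLocalRing (locAtCentre A.toSubring O) →
    ringKrullDim (locAtCentre A.toSubring O) = 3 →
    (∀ (T : Subring K) (hT : T ≤ O.toSubring), A.toSubring ≤ T → (subringCentre T O hT).IsMaximal) →
    ∀ g₀ : K, (∀ c : K, c ^ p ≠ g₀) →
    (∀ f₀ : K, ∃ f₁ : K, O.valuation (g₀ - f₁ ^ p) < O.valuation (g₀ - f₀ ^ p)) →
    (∀ hk : ∀ c : k, algebraMap k K c ∈ O, transcendenceDefect k O hk ≠ 0) →
    ¬ (∃ π : K, π ≠ 0 ∧ (∀ x : K, O.valuation x < 1 → O.valuation x ≤ O.valuation π) ∧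
      (∀ x : K, x ≠ 0 → ∃ n : ℕ, O.valuation π ^ n ≤ O.valuation x)) →
    ¬ (∃ (O₁ : ValuationSubring K), O ≤ O₁ ∧ O₁ ≠ ⊤ ∧ ∃ y : Fin 2 → K, (∀ i, y i ∈ O) ∧
      ∀ P : MvPolynomial (Fin 2) k, P ≠ 0 → O₁.valuation (MvPolynomial.aeval y P) = 1) →
    ¬ ((∃ x y : K, x ≠ 0 ∧ y ≠ 0 ∧ ∀ a b : ℕ, a < p → b < p → (a ≠ 0 ∨ b ≠ 0) →
        ∀ z : K, z ≠ 0 → O.valuation (x ^ a * y ^ b) ≠ O.valuation (z ^ p)) ∧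
      ∃ r : ℕ, Module.finrank (Subfield.closure (Set.range (fun x : k => x ^ p))) k = p ^ r ∧
        Module.finrank (Subfield.closure (Set.range (fun x : IsLocalRing.ResidueField O => x ^ p))) (IsLocalRing.ResidueField O) = p ^ r) →
    ¬ ((∃ x y : K, x ≠ 0 ∧ y ≠ 0 ∧ ∀ a b : ℕ, a < p → b < p → (a ≠ 0 ∨ b ≠ 0) →
        ∀ z : K, z ≠ 0 → O.valuation (x ^ a * y ^ b) ≠ O.valuation (z ^ p)) ∧
      ∃ k' : IntermediateField k K, FiniteDimensional k k' ∧
        (∃ (n : ℕ) (s : Fin n → K), AlgebraicIndependent k' s ∧ Algebra.IsSeparable (IntermediateField.adjoin k' (Set.range s)) K) ∧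
        ∃ _ : Algebra k' (IsLocalRing.ResidueField O),
          (∀ (c : k') (h : algebraMap k' K c ∈ O),
            algebraMap k' (IsLocalRing.ResidueField O) c = IsLocalRing.residue O ⟨algebraMap k' K c, h⟩) ∧
          Algebra.IsSeparable k' (IsLocalRing.ResidueField O)) →
    ¬ IsAlgClosed k →
    ¬ (∃ O₁ : ValuationSubring K, O ≤ O₁ ∧ O₁ ≠ O ∧ O₁ ≠ ⊤) →
    ¬ (∃ (A' : Subalgebra k K) (_ : A'.toSubring ≤ O.toSubring) (_ : A ≤ A') (_ : A'.FG)
        (_ : IsRegularLocalRing (locAtCentre A'.toSubring O)) (c : Fin p → K) (_ : ∃ j : Fin p, (j : ℕ) ≠ 0 ∧ c j ≠ 0)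
        (h : ↥(locAtCentre A'.toSubring O)) (_ : (∑ j : Fin p, c j ^ p * g₀ ^ (j : ℕ)) = (h : K))
        (d : ℕ) (_ : 0 < d) (_ : (IsLocalRing.maximalIdeal ↥(locAtCentre A'.toSubring O)).spanFinrank = d)
        (t : Fin d → ↥(locAtCentre A'.toSubring O)) (_ : Ideal.span (Set.range t) = IsLocalRing.maximalIdeal ↥(locAtCentre A'.toSubring O))
        (F : MvPolynomial (Fin d) ↥(locAtCentre A'.toSubring O)) (e N : ℕ) (_ : F.IsHomogeneous e) (_ : ¬ p ∣ e) (_ : e ≤ N + 1),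
        h - MvPolynomial.aeval t F ∈ IsLocalRing.maximalIdeal ↥(locAtCentre A'.toSubring O) ^ (e + 1) ∧
        ∀ i, ∃ b : Fin d → ↥(locAtCentre A'.toSubring O),
          (∀ l, b l ∈ IsLocalRing.maximalIdeal ↥(locAtCentre A'.toSubring O) ^ (N + 1 - e)) ∧
          t i ^ N - ∑ l, b l * MvPolynomial.aeval t (MvPolynomial.pderiv l F) ∈
            IsLocalRing.maximalIdeal ↥(locAtCentre A'.toSubring O) ^ (N + 1)) →
    ∃ (A' : Subalgebra k K), A'.toSubring ≤ O.toSubring ∧ A ≤ A' ∧ A'.FG ∧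
    ∃ (_ : IsRegularLocalRing (locAtCentre A'.toSubring O)) (c : Fin p → K), (∃ j : Fin p, (j : ℕ) ≠ 0 ∧ c j ≠ 0) ∧
    ((∃ (d m : ℕ) (hmd : m ≤ d) (t : Fin d → ↥(locAtCentre A'.toSubring O)) (a : Fin m → ℕ) (u : ↥(locAtCentre A'.toSubring O)), IsUnit u ∧
    Ideal.span (Set.range t) = IsLocalRing.maximalIdeal ↥(locAtCentre A'.toSubring O) ∧
    ringKrullDim ↥(locAtCentre A'.toSubring O) = (d : WithBot ℕ∞) ∧ 0 < m ∧ (∀ i, ¬ p ∣ a i) ∧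
    (∑ j : Fin p, c j ^ p * g₀ ^ (j : ℕ)) = (u : K) * ∏ i : Fin m, ((t (Fin.castLE hmd i) : ↥(locAtCentre A'.toSubring O)) : K) ^ (a i)) ∨
    (∃ u : ↥(locAtCentre A'.toSubring O), IsUnit u ∧ (∑ j : Fin p, c j ^ p * g₀ ^ (j : ℕ)) = (u : K) ∧
    ∀ c' : ↥(locAtCentre A'.toSubring O), u - c' ^ p ∉ IsLocalRing.maximalIdeal ↥(locAtCentre A'.toSubring O)) ∨
    (∃ s c' : ↥(locAtCentre A'.toSubring O), (∑ j : Fin p, c j ^ p * g₀ ^ (j : ℕ)) = (s : K) ∧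
    s - c' ^ p ∈ IsLocalRing.maximalIdeal ↥(locAtCentre A'.toSubring O) ∧
    s - c' ^ p ∉ IsLocalRing.maximalIdeal ↥(locAtCentre A'.toSubring O) ^ 2)) := by
  sorry

/-- COMPOSITION (kernel-checked, rev 25/26/27/29/30/31): the rev-20/24 statement of `stub_cleanLU3DefectNonDiscrete` (classes (B)/(C)) from the KERNEL-CLOSED (C-div)
slice ✓ `cleanLU3Defect_of_divisorialCoarsening_cp` (`Theorems/RadicialJungCleanModelsCleanLU3CompositeCdivCP.lean`, rev 31; inputs F-32 via ✓ `stub_cjs2020Cor15`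
and F-02 = `stub_cossartPiltant2019` — rev 25–30 used ✓ `cleanLU3Defect_of_divisorialCoarsening` with F-78 `stub_cjs2020General` instead), the KERNEL-CLOSED (C-curve) slice ✓ `Ccurve.cleanLU3Defect_of_properCoarsening_perfect` (rev 29; input F-02 only), the KERNEL-CLOSED T-slice ✓ `Lens5.PRankTwoAssembly.cleanLU3DefectPRankTwo_of_cossartPiltant2019` (rev 26; inputs F-02 = `stub_cossartPiltant2019`,
F-32), the KERNEL-CLOSED `k = k̄` slice ✓ `Lens5.KbarCossart.cleanLU3DefectNonDiscrete_algClosed_of_cossart1987Thm` (rev 27; input F-112 =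
`stub_cossart1987Thm`), the KERNEL-CLOSED minimal-defect slice ✓ `Lens5TFrame.cleanLU3DefectPRankTwoPDeg_of_pMon` (rev 32; THEOREM T⁗‴ of res-B-lens-5, ported; inputs F-02 + F-32), the KERNEL-CLOSED
separable-constants slice ✓ `Lens5TFrame.cleanLUConcl_of_sepConst` (rev 33; THEOREMS T″/T‴ of res-B-lens-5, ported; inputs F-02 + F-32) and the narrowed research stub, by excluded middle on «`O` has a divisorial coarsening», «`k` perfect and `[Γ:pΓ] = p²`»,
«`k` algebraically closed». [folklore] -/
theorem cleanLU3DefectNonDiscrete_of_stubs :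
    ∀ (p : ℕ), p.Prime → p ≠ 2 →
    ∀ (k : Type) [Field k] [CharP k p] (K : Type) [Field K] [Algebra k K]
    (O : ValuationSubring K) (A : Subalgebra k K), A.toSubring ≤ O.toSubring → A.FG → IsFractionRing A K →
    ringKrullDim A ≤ 3 → IsRegularLocalRing (locAtCentre A.toSubring O) →
    ringKrullDim (locAtCentre A.toSubring O) = 3 →
    (∀ (T : Subring K) (hT : T ≤ O.toSubring), A.toSubring ≤ T → (subringCentre T O hT).IsMaximal) →
    ∀ g₀ : K, (∀ c : K, c ^ p ≠ g₀) →
    (∀ f₀ : K, ∃ f₁ : K, O.valuation (g₀ - f₁ ^ p) < O.valuation (g₀ - f₀ ^ p)) →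
    (∀ hk : ∀ c : k, algebraMap k K c ∈ O, transcendenceDefect k O hk ≠ 0) →
    ¬ (∃ π : K, π ≠ 0 ∧ (∀ x : K, O.valuation x < 1 → O.valuation x ≤ O.valuation π) ∧
      (∀ x : K, x ≠ 0 → ∃ n : ℕ, O.valuation π ^ n ≤ O.valuation x)) →
    ∃ (A' : Subalgebra k K), A'.toSubring ≤ O.toSubring ∧ A ≤ A' ∧ A'.FG ∧
    ∃ (_ : IsRegularLocalRing (locAtCentre A'.toSubring O)) (c : Fin p → K), (∃ j : Fin p, (j : ℕ) ≠ 0 ∧ c j ≠ 0) ∧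
    ((∃ (d m : ℕ) (hmd : m ≤ d) (t : Fin d → ↥(locAtCentre A'.toSubring O)) (a : Fin m → ℕ) (u : ↥(locAtCentre A'.toSubring O)), IsUnit u ∧
    Ideal.span (Set.range t) = IsLocalRing.maximalIdeal ↥(locAtCentre A'.toSubring O) ∧
    ringKrullDim ↥(locAtCentre A'.toSubring O) = (d : WithBot ℕ∞) ∧ 0 < m ∧ (∀ i, ¬ p ∣ a i) ∧
    (∑ j : Fin p, c j ^ p * g₀ ^ (j : ℕ)) = (u : K) * ∏ i : Fin m, ((t (Fin.castLE hmd i) : ↥(locAtCentre A'.toSubring O)) : K) ^ (a i)) ∨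
    (∃ u : ↥(locAtCentre A'.toSubring O), IsUnit u ∧ (∑ j : Fin p, c j ^ p * g₀ ^ (j : ℕ)) = (u : K) ∧
    ∀ c' : ↥(locAtCentre A'.toSubring O), u - c' ^ p ∉ IsLocalRing.maximalIdeal ↥(locAtCentre A'.toSubring O)) ∨
    (∃ s c' : ↥(locAtCentre A'.toSubring O), (∑ j : Fin p, c j ^ p * g₀ ^ (j : ℕ)) = (s : K) ∧
    s - c' ^ p ∈ IsLocalRing.maximalIdeal ↥(locAtCentre A'.toSubring O) ∧
    s - c' ^ p ∉ IsLocalRing.maximalIdeal ↥(locAtCentre A'.toSubring O) ^ 2)) := by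
  intro p hp hp2 k _ _ K _ _ O A hAO hAfg hfrac hdimA hreg hdim3 hzd g₀ hg₀ hdefect htd hdisc
  by_cases hdiv : ∃ (O₁ : ValuationSubring K), O ≤ O₁ ∧ O₁ ≠ ⊤ ∧ ∃ y : Fin 2 → K, (∀ i, y i ∈ O) ∧
      ∀ P : MvPolynomial (Fin 2) k, P ≠ 0 → O₁.valuation (MvPolynomial.aeval y P) = 1
  · obtain ⟨O₁, hOO₁, hO₁, y, hy, hind⟩ := hdiv
    exact cleanLU3Defect_of_divisorialCoarsening_cp_thm11 stub_cp2019Thm11 stub_cossartPiltant2019 p hp k K O A hAO hAfg hfrac hdim3 hzd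
      g₀ hg₀ hdefect O₁ hOO₁ hO₁ y hy hind
  · by_cases hT : PerfectField k ∧ ∃ x y : K, x ≠ 0 ∧ y ≠ 0 ∧ ∀ a b : ℕ, a < p → b < p → (a ≠ 0 ∨ b ≠ 0) →
        ∀ z : K, z ≠ 0 → O.valuation (x ^ a * y ^ b) ≠ O.valuation (z ^ p)
    · obtain ⟨hperf, hP2⟩ := hT
      haveI := hperf
      haveI : Fact p.Prime := ⟨hp⟩
      exact Lens5.PRankTwoAssembly.cleanLU3DefectPRankTwo_of_cossartPiltant2019_thm11 p stub_cossartPiltant2019 stub_cp2019Thm11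
        k K O A hAO hAfg hfrac hdimA hreg hdim3 hzd g₀ hg₀ hdefect htd hdisc hP2
    · by_cases hT4 : (∃ x y : K, x ≠ 0 ∧ y ≠ 0 ∧ ∀ a b : ℕ, a < p → b < p → (a ≠ 0 ∨ b ≠ 0) →
          ∀ z : K, z ≠ 0 → O.valuation (x ^ a * y ^ b) ≠ O.valuation (z ^ p)) ∧
        ∃ r : ℕ, Module.finrank (Subfield.closure (Set.range (fun x : k => x ^ p))) k = p ^ r ∧
          Module.finrank (Subfield.closure (Set.range (fun x : IsLocalRing.ResidueField O => x ^ p))) (IsLocalRing.ResidueField O) = p ^ r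
      · obtain ⟨hP2, r, hk, hκ⟩ := hT4
        haveI : Fact p.Prime := ⟨hp⟩
        exact Summit.ResolutionOfSingularities.ResolutionOfSingularities.Theorems.RadicialJungCleanModels.Lens5TFrame.cleanLU3DefectPRankTwoPDeg_of_pMon p
          (Summit.ResolutionOfSingularities.ResolutionOfSingularities.Theorems.RadicialJungCleanModels.Lens5TFrame.cleanLU3DefectPRankTwoPMon_of_cossartPiltant2019_thm11
            p stub_cossartPiltant2019 stub_cp2019Thm11)
          k K O A hAO hAfg hfrac hdimA hreg hdim3 hzd g₀ hg₀ hdefect htd hdisc hP2 r hk hκ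
      · by_cases hT6 : (∃ x y : K, x ≠ 0 ∧ y ≠ 0 ∧ ∀ a b : ℕ, a < p → b < p → (a ≠ 0 ∨ b ≠ 0) →
            ∀ z : K, z ≠ 0 → O.valuation (x ^ a * y ^ b) ≠ O.valuation (z ^ p)) ∧
          ∃ k' : IntermediateField k K, FiniteDimensional k k' ∧
            (∃ (n : ℕ) (s : Fin n → K), AlgebraicIndependent k' s ∧ Algebra.IsSeparable (IntermediateField.adjoin k' (Set.range s)) K) ∧
            ∃ _ : Algebra k' (IsLocalRing.ResidueField O),
              (∀ (c : k') (h : algebraMap k' K c ∈ O),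
                algebraMap k' (IsLocalRing.ResidueField O) c = IsLocalRing.residue O ⟨algebraMap k' K c, h⟩) ∧
              Algebra.IsSeparable k' (IsLocalRing.ResidueField O)
        · haveI : Fact p.Prime := ⟨hp⟩
          exact Summit.ResolutionOfSingularities.ResolutionOfSingularities.Theorems.RadicialJungCleanModels.Lens5TFrame.cleanLUConcl_of_sepConst p
            (Summit.ResolutionOfSingularities.ResolutionOfSingularities.Theorems.RadicialJungCleanModels.Lens5TFrame.cleanLU3DefectPRankTwoSepConst_of_cossartPiltant2019 p stub_cossartPiltant2019
              (Summit.ResolutionOfSingularities.ResolutionOfSingularities.Theorems.RadicialJungCleanModels.Lens5TFrame.cleanLU3DefectPRankTwoSepRes_of_cossartPiltant2019_thm11 p stub_cossartPiltant2019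
                stub_cp2019Thm11))
            k K O A hAO hAfg hfrac hdimA hreg hdim3 hzd g₀ hg₀ hdefect htd hdisc hT6
        · by_cases halg : IsAlgClosed k
          · exact KbarRational.cleanLU3DefectNonDiscrete_algClosed_of_cossartRational p stub_cossart1987ThmRational hp k K O A hAO hAfg
              hfrac hdimA hreg hdim3 hzd g₀ hg₀ hdefect htd hdisc hdiv hT
          · by_cases hCc : ∃ O₁ : ValuationSubring K, O ≤ O₁ ∧ O₁ ≠ O ∧ O₁ ≠ ⊤
            · obtain ⟨O₁, hOO₁, hne, hO₁⟩ := hCc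
              exact Ccurve.cleanLU3Defect_of_properCoarsening stub_cossartPiltant2019 p hp k K O A hAO hAfg hfrac hdimA hreg hdim3 hzd
                g₀ hg₀ hdiv O₁ hOO₁ hne hO₁
            · by_cases hSmooth : ∃ (A' : Subalgebra k K) (_ : A'.toSubring ≤ O.toSubring) (_ : A ≤ A') (_ : A'.FG)
                  (_ : IsRegularLocalRing (locAtCentre A'.toSubring O)) (c : Fin p → K) (_ : ∃ j : Fin p, (j : ℕ) ≠ 0 ∧ c j ≠ 0)
                  (h : ↥(locAtCentre A'.toSubring O)) (_ : (∑ j : Fin p, c j ^ p * g₀ ^ (j : ℕ)) = (h : K))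
                  (d : ℕ) (_ : 0 < d) (_ : (IsLocalRing.maximalIdeal ↥(locAtCentre A'.toSubring O)).spanFinrank = d)
                  (t : Fin d → ↥(locAtCentre A'.toSubring O))
                  (_ : Ideal.span (Set.range t) = IsLocalRing.maximalIdeal ↥(locAtCentre A'.toSubring O))
                  (F : MvPolynomial (Fin d) ↥(locAtCentre A'.toSubring O)) (e N : ℕ) (_ : F.IsHomogeneous e) (_ : ¬ p ∣ e) (_ : e ≤ N + 1),
                  h - MvPolynomial.aeval t F ∈ IsLocalRing.maximalIdeal ↥(locAtCentre A'.toSubring O) ^ (e + 1) ∧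
                  ∀ i, ∃ b : Fin d → ↥(locAtCentre A'.toSubring O),
                    (∀ l, b l ∈ IsLocalRing.maximalIdeal ↥(locAtCentre A'.toSubring O) ^ (N + 1 - e)) ∧
                    t i ^ N - ∑ l, b l * MvPolynomial.aeval t (MvPolynomial.pderiv l F) ∈
                      IsLocalRing.maximalIdeal ↥(locAtCentre A'.toSubring O) ^ (N + 1)
              · obtain ⟨A', hA'O, hAA', hA'fg, hregA', c, hc0, h, hc, d, hd0, hd, t, ht, F, e, N, hF, hpe, hN, hQ, hsm⟩ := hSmooth
                exact ConeExit.cleanLUConcl_of_smoothCone hp O A A' hA'O hAA' hA'fg hregA' g₀ c hc0 h hc hd0 hd t ht F hF hpe hQ hN hsm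
              · exact stub_cleanLU3DefectNonDiscrete p hp hp2 k K O A hAO hAfg hfrac hdimA hreg hdim3 hzd g₀ hg₀ hdefect htd hdisc hdiv hT4
                  hT6 halg hCc hSmooth

/-- COMPOSITION (kernel-checked, rev 24/25): the rev-18 statement of `stub_cleanLU3Defect`, from the LANDED class (A) ✓ `cleanLU3DefectArc_of_discrete`
(LEMMA D-abs `Lens5.AbsDerivation.absDerivation_of_forall_pow_ne'` feeding THEOREM P `Lens5.ArcPotentialProof.arcPotential`) and the research stub
`stub_cleanLU3DefectNonDiscrete` (classes (B)/(C)), by excluded middle on «`O` is discrete of rank one». [folklore] -/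
theorem cleanLU3Defect_of_stubs :
    ∀ (p : ℕ), p.Prime → p ≠ 2 →
    ∀ (k : Type) [Field k] [CharP k p] (K : Type) [Field K] [Algebra k K]
    (O : ValuationSubring K) (A : Subalgebra k K), A.toSubring ≤ O.toSubring → A.FG → IsFractionRing A K →
    ringKrullDim A ≤ 3 → IsRegularLocalRing (locAtCentre A.toSubring O) →
    ringKrullDim (locAtCentre A.toSubring O) = 3 →
    (∀ (T : Subring K) (hT : T ≤ O.toSubring), A.toSubring ≤ T → (subringCentre T O hT).IsMaximal) →
    ∀ g₀ : K, (∀ c : K, c ^ p ≠ g₀) →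
    (∀ f₀ : K, ∃ f₁ : K, O.valuation (g₀ - f₁ ^ p) < O.valuation (g₀ - f₀ ^ p)) →
    (∀ hk : ∀ c : k, algebraMap k K c ∈ O, transcendenceDefect k O hk ≠ 0) →
    ∃ (A' : Subalgebra k K), A'.toSubring ≤ O.toSubring ∧ A ≤ A' ∧ A'.FG ∧
    ∃ (_ : IsRegularLocalRing (locAtCentre A'.toSubring O)) (c : Fin p → K), (∃ j : Fin p, (j : ℕ) ≠ 0 ∧ c j ≠ 0) ∧
    ((∃ (d m : ℕ) (hmd : m ≤ d) (t : Fin d → ↥(locAtCentre A'.toSubring O)) (a : Fin m → ℕ) (u : ↥(locAtCentre A'.toSubring O)), IsUnit u ∧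
    Ideal.span (Set.range t) = IsLocalRing.maximalIdeal ↥(locAtCentre A'.toSubring O) ∧
    ringKrullDim ↥(locAtCentre A'.toSubring O) = (d : WithBot ℕ∞) ∧ 0 < m ∧ (∀ i, ¬ p ∣ a i) ∧
    (∑ j : Fin p, c j ^ p * g₀ ^ (j : ℕ)) = (u : K) * ∏ i : Fin m, ((t (Fin.castLE hmd i) : ↥(locAtCentre A'.toSubring O)) : K) ^ (a i)) ∨
    (∃ u : ↥(locAtCentre A'.toSubring O), IsUnit u ∧ (∑ j : Fin p, c j ^ p * g₀ ^ (j : ℕ)) = (u : K) ∧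
    ∀ c' : ↥(locAtCentre A'.toSubring O), u - c' ^ p ∉ IsLocalRing.maximalIdeal ↥(locAtCentre A'.toSubring O)) ∨
    (∃ s c' : ↥(locAtCentre A'.toSubring O), (∑ j : Fin p, c j ^ p * g₀ ^ (j : ℕ)) = (s : K) ∧
    s - c' ^ p ∈ IsLocalRing.maximalIdeal ↥(locAtCentre A'.toSubring O) ∧
    s - c' ^ p ∉ IsLocalRing.maximalIdeal ↥(locAtCentre A'.toSubring O) ^ 2)) := by
  intro p hp hp2 k _ _ K _ _ O A hAO hAfg hfrac hdimA hreg hdim3 hzd g₀ hg₀ hdefect htd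
  by_cases hdisc : (∃ π : K, π ≠ 0 ∧ (∀ x : K, O.valuation x < 1 → O.valuation x ≤ O.valuation π) ∧
      (∀ x : K, x ≠ 0 → ∃ n : ℕ, O.valuation π ^ n ≤ O.valuation x))
  · exact cleanLU3DefectArc_of_discrete p hp k K O A hAO hAfg hfrac hdimA hreg hdim3 hzd g₀ hg₀ hdefect htd hdisc
  · exact cleanLU3DefectNonDiscrete_of_stubs p hp hp2 k K O A hAO hAfg hfrac hdimA hreg hdim3 hzd g₀ hg₀ hdefect htd hdisc

/-- COMPOSITION (kernel-checked, rev 18; rev 33: the case `p = 2` FIRST, from the printed stub `stub_cp2019Thm15iBaseSidePhaseTwo` alone via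
✓ `Lens5.PTwo.cleanLU3_of_eq_two_of_phaseTwo`): clean local uniformization at ZERO-DIMENSIONAL valuation rings with a 3-dimensional regular
centre — the hypothesis of the landed 4a variant `cleanCharts3_of_cleanLU3ZeroDim` — from the printed fact `stub_cjs2020Cor15`, the LANDED
defectless half `cleanLU3_of_isMin_pthPowerApprox` (✓ p677129), the LANDED Abhyankar case `cleanLU3_of_transcendenceDefect_eq_zero`
(Kuhlmann) and the recomposed residue `cleanLU3Defect_of_stubs` (rev 20) — excluded middle on «`g₀` has a best `p`-th-power approximation» and on
«transcendence defect `= 0`». [folklore] -/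
theorem cleanLU3_of_stubs :
    ∀ (p : ℕ), p.Prime →
    ∀ (k : Type) [Field k] [CharP k p] (K : Type) [Field K] [Algebra k K]
    (O : ValuationSubring K) (A : Subalgebra k K), A.toSubring ≤ O.toSubring → A.FG → IsFractionRing A K →
    ringKrullDim A ≤ 3 → IsRegularLocalRing (locAtCentre A.toSubring O) →
    ringKrullDim (locAtCentre A.toSubring O) = 3 →
    (∀ (T : Subring K) (hT : T ≤ O.toSubring), A.toSubring ≤ T → (subringCentre T O hT).IsMaximal) →
    ∀ g₀ : K, (∀ c : K, c ^ p ≠ g₀) →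
    ∃ (A' : Subalgebra k K), A'.toSubring ≤ O.toSubring ∧ A ≤ A' ∧ A'.FG ∧
    ∃ (_ : IsRegularLocalRing (locAtCentre A'.toSubring O)) (c : Fin p → K), (∃ j : Fin p, (j : ℕ) ≠ 0 ∧ c j ≠ 0) ∧
    ((∃ (d m : ℕ) (hmd : m ≤ d) (t : Fin d → ↥(locAtCentre A'.toSubring O)) (a : Fin m → ℕ) (u : ↥(locAtCentre A'.toSubring O)), IsUnit u ∧
    Ideal.span (Set.range t) = IsLocalRing.maximalIdeal ↥(locAtCentre A'.toSubring O) ∧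
    ringKrullDim ↥(locAtCentre A'.toSubring O) = (d : WithBot ℕ∞) ∧ 0 < m ∧ (∀ i, ¬ p ∣ a i) ∧
    (∑ j : Fin p, c j ^ p * g₀ ^ (j : ℕ)) = (u : K) * ∏ i : Fin m, ((t (Fin.castLE hmd i) : ↥(locAtCentre A'.toSubring O)) : K) ^ (a i)) ∨
    (∃ u : ↥(locAtCentre A'.toSubring O), IsUnit u ∧ (∑ j : Fin p, c j ^ p * g₀ ^ (j : ℕ)) = (u : K) ∧
    ∀ c' : ↥(locAtCentre A'.toSubring O), u - c' ^ p ∉ IsLocalRing.maximalIdeal ↥(locAtCentre A'.toSubring O)) ∨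
    (∃ s c' : ↥(locAtCentre A'.toSubring O), (∑ j : Fin p, c j ^ p * g₀ ^ (j : ℕ)) = (s : K) ∧
    s - c' ^ p ∈ IsLocalRing.maximalIdeal ↥(locAtCentre A'.toSubring O) ∧
    s - c' ^ p ∉ IsLocalRing.maximalIdeal ↥(locAtCentre A'.toSubring O) ^ 2)) := by
  intro p hp k _ _ K _ _ O A hAO hAfg hfrac hdimA hreg hdim3 hzd g₀ hg₀
  by_cases hp2 : p = 2
  · exact Lens5.PTwo.cleanLU3_of_eq_two_of_phaseTwo stub_cp2019Thm15iBaseSidePhaseTwo p hp hp2 k K O A hAO hAfg hfrac hdimA hreg hdim3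
      hzd g₀ hg₀
  by_cases hbest : ∃ f₀ : K, ∀ f : K, O.valuation (g₀ - f₀ ^ p) ≤ O.valuation (g₀ - f ^ p)
  · obtain ⟨f₀, hf₀⟩ := hbest
    exact cleanLU3_of_isMin_pthPowerApprox_of_thm11 stub_cp2019Thm11 p hp k K O A hAO hAfg hfrac hreg hdim3 g₀ hg₀ f₀ hf₀
  · push Not at hbest
    have hk : ∀ c : k, algebraMap k K c ∈ O := fun c => hAO (A.algebraMap_mem c)
    by_cases htd : transcendenceDefect k O hk = 0
    · exact cleanLU3_of_transcendenceDefect_eq_zero_of_thm11 stub_cp2019Thm11 p hp k K O A hAO hAfg hfrac hreg hdim3 g₀ hg₀ hk htd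
    · exact cleanLU3Defect_of_stubs p hp hp2 k K O A hAO hAfg hfrac hdimA hreg hdim3 hzd g₀ hg₀ hbest
        (fun hk' => (by exact htd : transcendenceDefect k O hk ≠ 0))

/-!
## The former stub `stub_cleanPatching3` («patching for clean pairs in dimension 3»), CUT (rev 14)

Zariski's Patching Theorem in the axiomatic form of Piltant 2013 (RACSAM 107, Thm. 2.4 / Prop. 5.1 / Cor. 5.7) for the
regularity property `P_clean(g₀)` of `RadicialJungCleanModelsCleanPatchingDefs.lean` (`CleanRegAt` / `ModelCleanRegAt`),
TRANSFERRED from the tree's PROVED `P_reg` chain (`ResolvingSystems`, `ZariskiPatchingGlue`, `PatchingMorphismStep`,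
`PatchingStepFive`, `BadCurveStep`, `BadCurveInduction` — `RegLe ↦ ModelCleanRegLe`, opens of the regular locus ↦ opens
of clean-regular points), along the converged stub plans res-B-lens-1 g2 ADDENDUM A §3/§3.1 and res-B-lens-5 g2 STUBPLAN
§4 (both in `Cruxes/DescentPerfectToAll/`).  Design choices (lead): (i) Piltant's Axiom 1 (openness of `Reg_P`) at
NON-closed points is AVOIDED — the resolving system is built from CLEAN CHARTS found inside ZERO-DIMENSIONAL refinements of
the valuations (`stub_cleanCharts3`: there every centre is closed, so the landed closed-point openness `stub_cleanSpreads` +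
generisation `stub_looseGenerises` suffice), and the two-model patching is stated for arbitrary OPENS of clean-regular points
(`stub_cleanTwoModelPatching3`, the form in which `ProjModel.exists_regLe_pair_over` is proved anyway); (ii) Piltant's
Axiom 4 for `P_clean` = Cossart–Piltant Prop. 4.4 KEEPING CLEANNESS (`stub_cleanPrincipalization3`, the ONE research
residue, stated on an everywhere-clean regular excellent threefold — it is applied to the open subschemes of (i)) is cut
by the dimension-free closed-point survival lemma `stub_cleanPointBlowup` (Axiom 2 (ii) at closed points; lens-1 §3.1);
(iii) the glue `stub_cleanGlobalization3` (Chow + projective closure + Zariski compactness over the valuations CENTRED ON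
`W` + `n − 1` dominations + restriction over `W`) returns the `W`-form consumed by the landed pointwise reduction p657305.
-/

-- STUB 4a `stub_cleanCharts3` is LANDED (✓ p669538, `Theorems/RadicialJungCleanModelsStubCleanCharts3.lean`, same FQN; helpers
-- ✓ p668003 CleanRegTransport, ✓ p668430 ZeroDimValuations, ✓ p669205 CleanChartsSpread): used below BY NAME from the import.

-- STUB 4b `stub_cleanTwoModelPatching3` (two-model patching for `P_clean`, open form) is LANDED (✓ p671093,
-- `Theorems/RadicialJungCleanModelsStubCleanTwoModelPatching3.lean`, same FQN, seat deleg-15917-cleanCharts3-g0; helpers ✓ p670022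
-- ✓ p670517 ✓ p670681 ✓ p670710): used below BY NAME from the import.

-- STUB 4c `stub_cleanGlobalization3` (THE GLUE) is LANDED (✓ p672722, `Theorems/RadicialJungCleanModelsStubCleanGlobalization3.lean`,
-- same FQN; helpers ✓ p669696 CleanPatchingDomination, ✓ p669888 ChartStalkSubring, ✓ p670456 CleanChartModel, ✓ p670574
-- CleanResolvingSystem, ✓ p671054 ModelOfOpenImmersion, ✓ p671210 CentreCharts, ✓ p671597 WCharts): used below BY NAME from the import.

-- STUB 4d `stub_cleanPointBlowup` (cleanness survives closed-point blow-ups) is LANDED (✓ p671162,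
-- `Theorems/RadicialJungCleanModelsStubCleanPointBlowup.lean`, same FQN, seat deleg-15917-cleanPointBlowup-g0; helpers ✓ p670168
-- ✓ p670850): used below BY NAME from the import (it is the hypothesis `hT2` of 4e).

/-- STUB 4e′ (OURS, RESEARCH RESIDUE of 4e, rev 28 RE-CUT along res-B-princ3's two LANDED reductions; NOT IN PRINT as stated): **X44c = CLEAN
Cossart–Piltant 2008 Prop. 4.4 on clean stages over regular excellent threefolds** — VERBATIM the tree's PROVED `CossartPiltant2008_prop44`
(✓ `CP2008Prop44.cossartPiltant2008_prop44_holds`: embedded resolution of an idealistic exponent `(J, μ)` — `μ ≥ 1` the maximal order, `V(J)` of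
codimension `≥ 2` — by a permissible sequence of blowing ups in regular integral centres inside `{ord = μ}`) with «permissible» STRENGTHENED to
«clean-permissible» (`IsCleanPermissibleSeq`: every centre is `CleanPermissibleAt` for the current transform of `G₀`) and the stage `ρ : X → S`
assumed clean (`IsCleanRegularCentreBlowupSeq p ρ I G₀`, the line of `ρ^♯ G₀` clean-regular at every point).  It is the hypothesis `h44c` of
✓ `cleanPermissiblePrincipalization3_of_cleanProp44` (`Theorems/RadicialJungCleanModelsCleanPrincipalizationOfProp44.lean`, res-B-princ3 g0, ✓ p684619:
X44c ⟹ X_perm by the printed proof of [CoP1] Prop. 4.2 — divisorial decomposition, order bound, induction on `μ`, clean transport), and X_perm is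
the hypothesis `hX` of ✓ `stub_cleanPrincipalization3_of_cleanPermissiblePrincipalization` (`…CleanPermissibleSeq.lean`, ✓ p683310: X_perm ⟹ 4e).
res-B-princ3's census (memo `Lines/Sketch-memo-4e-cleanPermissible.md` rev 11.5, §4/§5b): X44c is FREE at every point centre (✓
`cleanPermissible_of_cleanRegAt`; corner chains ✓ p688874; contact chains ✓ p691104/p691423/p691777) and OPEN exactly where a curve is blown up
(near lines of the `τ = 1` slice, reach-tidy step 3); X44c ⟸ O1 ∧ … ∧ O8 (ports of [CJS 2020] Ch. 4–6 «boundary with history» onto the clean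
threefold + (B5′) constant-type birth chains over imperfect residue fields, the one research item; res-B-lens-6 g11–g13's game-level texts
L-A/L-B/L-C/L-Π cover O5 for `μ = 2 < p`, `k̄`).  Registered so that the skeleton consumes res-B-princ3's landed reductions BY NAME (one step back, X_perm, is available by ✓ p683310 alone).
[cite: CossartPiltant2008, Prop. 4.4 and proof of Prop. 4.2] [cite: Piltant2013, §2 Axiom 4] -/
theorem stub_cleanProp44 :
    ∀ (p : ℕ), p.Prime → ∀ (S : Scheme.{0}) [IsIntegral S] [IsNoetherian S],
      CharP S.functionField p → Scheme.IsRegular S → Scheme.IsExcellent S → topologicalKrullDim S = 3 →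
      ∀ G₀ : S.functionField, (∀ s : S, CleanRegAt p (algebraMap (S.presheaf.stalk s) S.functionField) G₀) →
      ∀ I : S.IdealSheafData, I ≠ ⊥ →
      ∀ (X : Scheme.{0}) (ρ : X ⟶ S) [IsIntegral X] [IsNoetherian X] [IsDominant ρ],
        IsCleanRegularCentreBlowupSeq p ρ I G₀ →
        (∀ x : X, CleanRegAt p (algebraMap (X.presheaf.stalk x) X.functionField) (RatFn.functionFieldMap ρ G₀)) →
        ∀ (J : X.IdealSheafData) (μ : ℕ), 1 ≤ μ →
          (∀ x ∈ J.support, 1 < Order.coheight x) → (∀ x, idealOrder J x ≤ μ) → (∃ x, idealOrder J x = μ) →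
          ∃ (X' : Scheme.{0}) (π : X' ⟶ X) (_ : IsIntegral X') (_ : IsDominant π) (J' : X'.IdealSheafData),
            IsCleanPermissibleSeq p π J μ J' (RatFn.functionFieldMap ρ G₀) ∧ ∀ x, idealOrder J' x < μ := by
  sorry

/-- NODE 4e (kernel-checked, rev 28; formerly the registered research stub `stub_cleanPrincipalization3`, rev 14–27 — statement UNCHANGED):
**`CleanPrincipalization₃`** = Piltant's Axiom 4 for `P = P_clean`, alias Cossart–Piltant 2019 Prop. 4.4 KEEPING CLEANNESS: on a regular excellent
integral Noetherian threefold `S` (function field of characteristic `p`) on which the line of `G` is clean-regular at EVERY point, every non-zero ideal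
sheaf `J` is principalized by a composition `σ` of blowing ups along regular centres in the non-locally-principal loci (the conclusion of the named fact
`CossartPiltant2019Principalization`, verbatim) such that the line stays clean-regular at every point upstairs.  NOW DERIVED from the narrower registered
stub `stub_cleanProp44` (X44c) by res-B-princ3's LANDED reductions ✓ `cleanPermissiblePrincipalization3_of_cleanProp44` (X44c ⟹ X_perm, ✓ p684619) and
✓ `stub_cleanPrincipalization3_of_cleanPermissiblePrincipalization` (X_perm ⟹ 4e, ✓ p683310; the closed-point hypothesis `hT2` = ✓ 4d is no longer
consumed — clean-permissible centre blow-ups keep cleanness by ✓ `cleanRegAt_of_isBlowup_of_cleanPermissible`, res-B-princ3 ✓ p682866).  Typed candidate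
first filed by res-B-lens-5 g2 (`Cruxes/DescentPerfectToAll/STUBPLAN_cleanPatching3_T4T2.lean`), here in the line's currency `CleanRegAt`.
[cite: Piltant2013, §2 Axiom 4 and Prop. 4.2] [cite: CossartPiltant2019, Prop. 4.4] -/
theorem stub_cleanPrincipalization3
    (hT2 : ∀ (p : ℕ), p.Prime → ∀ (S : Scheme.{0}) [IsIntegral S] [IsNoetherian S], CharP S.functionField p →
    ∀ (G : S.functionField) (s : S) (hs : IsClosed ({s} : Set S)),
    CleanRegAt p (algebraMap (S.presheaf.stalk s) S.functionField) G →
    ∀ (S' : Scheme.{0}) (τ : S' ⟶ S) [IsIntegral S'] [IsDominant τ],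
    IsBlowup τ (Scheme.IdealSheafData.vanishingIdeal ⟨{s}, hs⟩) →
    ∀ s' : S', τ s' = s →
    CleanRegAt p (algebraMap (S'.presheaf.stalk s') S'.functionField) (RatFn.functionFieldMap τ G)) :
    ∀ (p : ℕ), p.Prime → ∀ (S : Scheme.{0}) [IsIntegral S] [IsNoetherian S],
      CharP S.functionField p → Scheme.IsRegular S → Scheme.IsExcellent S → topologicalKrullDim S = 3 →
      ∀ G : S.functionField, (∀ s : S, CleanRegAt p (algebraMap (S.presheaf.stalk s) S.functionField) G) →
      ∀ J : S.IdealSheafData, J ≠ ⊥ →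
        ∃ (S' : Scheme.{0}) (σ : S' ⟶ S) (_ : IsIntegral S') (_ : IsDominant σ),
          IsRegularCentreBlowupSeq σ J ∧ IsLocallyPrincipal (J.comap σ) ∧
          ∀ s' : S', CleanRegAt p (algebraMap (S'.presheaf.stalk s') S'.functionField) (RatFn.functionFieldMap σ G) :=
  stub_cleanPrincipalization3_of_cleanPermissiblePrincipalization
    (cleanPermissiblePrincipalization3_of_cleanProp44 stub_cleanProp44) hT2

/-- COMPOSITION (kernel-checked): the former `stub_cleanPatching3`, now from stubs 4a–4e (its F-75c hypothesis is no
longer needed: lower-dimensional centres are handled by zero-dimensional refinement inside `stub_cleanCharts3`; rev 18: clean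
LU is consumed at zero-dimensional valuations only, `cleanCharts3_of_cleanLU3ZeroDim`). [folklore] -/
theorem cleanPatching3_of_stubs
    (hLU : ∀ (p : ℕ), p.Prime →
    ∀ (k : Type) [Field k] [CharP k p] (K : Type) [Field K] [Algebra k K]
    (O : ValuationSubring K) (A : Subalgebra k K), A.toSubring ≤ O.toSubring → A.FG → IsFractionRing A K →
    ringKrullDim A ≤ 3 → IsRegularLocalRing (locAtCentre A.toSubring O) →
    ringKrullDim (locAtCentre A.toSubring O) = 3 →
    (∀ (T : Subring K) (hT : T ≤ O.toSubring), A.toSubring ≤ T → (subringCentre T O hT).IsMaximal) →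
    ∀ g₀ : K, (∀ c : K, c ^ p ≠ g₀) →
    ∃ (A' : Subalgebra k K), A'.toSubring ≤ O.toSubring ∧ A ≤ A' ∧ A'.FG ∧
    ∃ (_ : IsRegularLocalRing (locAtCentre A'.toSubring O)) (c : Fin p → K), (∃ j : Fin p, (j : ℕ) ≠ 0 ∧ c j ≠ 0) ∧
    ((∃ (d m : ℕ) (hmd : m ≤ d) (t : Fin d → ↥(locAtCentre A'.toSubring O)) (a : Fin m → ℕ) (u : ↥(locAtCentre A'.toSubring O)), IsUnit u ∧
    Ideal.span (Set.range t) = IsLocalRing.maximalIdeal ↥(locAtCentre A'.toSubring O) ∧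
    ringKrullDim ↥(locAtCentre A'.toSubring O) = (d : WithBot ℕ∞) ∧ 0 < m ∧ (∀ i, ¬ p ∣ a i) ∧
    (∑ j : Fin p, c j ^ p * g₀ ^ (j : ℕ)) = (u : K) * ∏ i : Fin m, ((t (Fin.castLE hmd i) : ↥(locAtCentre A'.toSubring O)) : K) ^ (a i)) ∨
    (∃ u : ↥(locAtCentre A'.toSubring O), IsUnit u ∧ (∑ j : Fin p, c j ^ p * g₀ ^ (j : ℕ)) = (u : K) ∧
    ∀ c' : ↥(locAtCentre A'.toSubring O), u - c' ^ p ∉ IsLocalRing.maximalIdeal ↥(locAtCentre A'.toSubring O)) ∨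
    (∃ s c' : ↥(locAtCentre A'.toSubring O), (∑ j : Fin p, c j ^ p * g₀ ^ (j : ℕ)) = (s : K) ∧
    s - c' ^ p ∈ IsLocalRing.maximalIdeal ↥(locAtCentre A'.toSubring O) ∧
    s - c' ^ p ∉ IsLocalRing.maximalIdeal ↥(locAtCentre A'.toSubring O) ^ 2))) :
    ∀ (p : ℕ), p.Prime → ∀ (k : Type) [Field k] [CharP k p] (W : Scheme.{0}) [IsIntegral W]
      (f : W ⟶ Spec (.of k)) [IsSeparated f] [LocallyOfFiniteType f] [QuasiCompact f],
      Scheme.IsRegular W → ¬ topologicalKrullDim W ≤ 2 → topologicalKrullDim W ≤ 3 →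
      ∀ g₀ : W.functionField, (∀ c : W.functionField, c ^ p ≠ g₀) →
      ∃ (V : Scheme.{0}) (π : V ⟶ W) (_ : IsIntegral V) (_ : IsDominant π),
        IsProper π ∧ IsBirational π ∧ Scheme.IsRegular V ∧
        ∀ v : V, ∃ c : Fin p → W.functionField, (∃ j : Fin p, (j : ℕ) ≠ 0 ∧ c j ≠ 0) ∧
          ((∃ (d m : ℕ) (hmd : m ≤ d) (t : Fin d → V.presheaf.stalk v) (a : Fin m → ℕ)
              (u : V.presheaf.stalk v), IsUnit u ∧
              Ideal.span (Set.range t) = IsLocalRing.maximalIdeal (V.presheaf.stalk v) ∧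
              ringKrullDim (V.presheaf.stalk v) = (d : WithBot ℕ∞) ∧ 0 < m ∧ (∀ i, ¬ p ∣ a i) ∧
              RatFn.functionFieldMap π (∑ j : Fin p, c j ^ p * g₀ ^ (j : ℕ)) =
                algebraMap (V.presheaf.stalk v) V.functionField
                  (u * ∏ i : Fin m, t (Fin.castLE hmd i) ^ (a i))) ∨
            (∃ u : V.presheaf.stalk v, IsUnit u ∧
              RatFn.functionFieldMap π (∑ j : Fin p, c j ^ p * g₀ ^ (j : ℕ)) =
                algebraMap (V.presheaf.stalk v) V.functionField u ∧
              ∀ c' : V.presheaf.stalk v,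
                u - c' ^ p ∉ IsLocalRing.maximalIdeal (V.presheaf.stalk v)) ∨
            (∃ s c' : V.presheaf.stalk v,
              RatFn.functionFieldMap π (∑ j : Fin p, c j ^ p * g₀ ^ (j : ℕ)) =
                algebraMap (V.presheaf.stalk v) V.functionField s ∧
              s - c' ^ p ∈ IsLocalRing.maximalIdeal (V.presheaf.stalk v) ∧
              s - c' ^ p ∉ IsLocalRing.maximalIdeal (V.presheaf.stalk v) ^ 2)) :=
  stub_cleanGlobalization3 (cleanCharts3_of_cleanLU3ZeroDim hLU)
    (stub_cleanTwoModelPatching3 (stub_cleanPrincipalization3 stub_cleanPointBlowup))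

/-- STUB 5 (OPEN — ON `DimensionFourFrontier`; no prover-hour): `RadicialJung.CleanModels` restricted to `dim W ≥ 4`.
[cite: HauserPerlega2019; CossartPiltant2019; Temkin2013 (arXiv:0804.1554) §1.3] -/
theorem stub_cleanModelsDimGEFour :
    ∀ p : ℕ, p.Prime → ∀ (k : Type) [Field k] [CharP k p] (W : AlgebraicGeometry.Scheme.{0}) [AlgebraicGeometry.IsIntegral W] (f : W ⟶ AlgebraicGeometry.Spec (.of k)) (L : Type) [Field L] [Algebra W.functionField L], AlgebraicGeometry.IsSeparated f → AlgebraicGeometry.LocallyOfFiniteType f → AlgebraicGeometry.QuasiCompact f → Literature.AlgebraicGeometry.Resolution.Scheme.IsRegular W → IsPurelyInseparable W.functionField L → Module.finrank W.functionField L = p → ¬ topologicalKrullDim W ≤ 3 → ∃ (V : AlgebraicGeometry.Scheme.{0}) (π : V ⟶ W) (_ : AlgebraicGeometry.IsIntegral V) (_ : AlgebraicGeometry.IsDominant π), AlgebraicGeometry.IsProper π ∧ Literature.AlgebraicGeometry.Resolution.IsBirational π ∧ Literature.AlgebraicGeometry.Resolution.Scheme.IsRegular V ∧ (∀ v : V,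 (∃ (y : L) (g : W.functionField), y ∉ Set.range (algebraMap W.functionField L) ∧ algebraMap W.functionField L g = y ^ p ∧ ((∃ (d m : ℕ) (hmd : m ≤ d) (t : Fin d → V.presheaf.stalk v) (a : Fin m → ℕ), Ideal.span (Set.range t) = IsLocalRing.maximalIdeal (V.presheaf.stalk v) ∧ ringKrullDim (V.presheaf.stalk v) = (d : WithBot ℕ∞) ∧ 0 < m ∧ (∀ i, ¬ p ∣ a i) ∧ Literature.AlgebraicGeometry.Motives.RatFn.functionFieldMap π g = ∏ i : Fin m, (algebraMap (V.presheaf.stalk v) V.functionField (t (Fin.castLE hmd i))) ^ (a i)) ∨ (∃ u₀ : V.presheaf.stalk v, IsUnit u₀ ∧ Literature.AlgebraicGeometry.Motives.RatFn.functionFieldMap π g = algebraMap (V.presheaf.stalk v) V.functionField u₀ ∧ ((∀ c : V.presheaf.stalk v, u₀ - c ^ p ∉ IsLocalRing.maximalIdeal (V.presheaf.stalk v)) ∨ (∃ c : V.presheaf.stalk v, u₀ - c ^ p ∈ IsLocalRing.maximalIdeal (V.presheaf.stalk v) ∧ u₀ - c ^ p ∉ IsLocalRing.maximalIdeal (V.presheaf.stalk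 v) ^ 2)))))) := by
  sorry

/-- GLUE (kernel-checked): the dim-3 slice of the crux from stubs 1–4, through the landed pointwise reduction
`cleanModelsDimThree_of_logCleanPrincipalizationDimThree` (p657305). [folklore] -/
theorem cleanModelsDimThree_of_stubs :
    ∀ p : ℕ, p.Prime → ∀ (k : Type) [Field k] [CharP k p] (W : AlgebraicGeometry.Scheme.{0}) [AlgebraicGeometry.IsIntegral W] (f : W ⟶ AlgebraicGeometry.Spec (.of k)) (L : Type) [Field L] [Algebra W.functionField L], AlgebraicGeometry.IsSeparated f → AlgebraicGeometry.LocallyOfFiniteType f → AlgebraicGeometry.QuasiCompact f → Literature.AlgebraicGeometry.Resolution.Scheme.IsRegular W → IsPurelyInseparable W.functionField L → Module.finrank W.functionField L = p → ¬ topologicalKrullDim W ≤ 2 → topologicalKrullDim W ≤ 3 → ∃ (V : AlgebraicGeometry.Scheme.{0}) (π : V ⟶ W) (_ : AlgebraicGeometry.IsIntegral V) (_ : AlgebraicGeometry.IsDominant π), AlgebraicGeometry.IsProper π ∧ Literature.AlgebraicGeometry.Resolution.IsBirational π ∧ Literature.AlgebraicGeometry.Resolution.Scheme.IsRegular V ∧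 (∀ v : V, (∃ (y : L) (g : W.functionField), y ∉ Set.range (algebraMap W.functionField L) ∧ algebraMap W.functionField L g = y ^ p ∧ ((∃ (d m : ℕ) (hmd : m ≤ d) (t : Fin d → V.presheaf.stalk v) (a : Fin m → ℕ), Ideal.span (Set.range t) = IsLocalRing.maximalIdeal (V.presheaf.stalk v) ∧ ringKrullDim (V.presheaf.stalk v) = (d : WithBot ℕ∞) ∧ 0 < m ∧ (∀ i, ¬ p ∣ a i) ∧ Literature.AlgebraicGeometry.Motives.RatFn.functionFieldMap π g = ∏ i : Fin m, (algebraMap (V.presheaf.stalk v) V.functionField (t (Fin.castLE hmd i))) ^ (a i)) ∨ (∃ u₀ : V.presheaf.stalk v, IsUnit u₀ ∧ Literature.AlgebraicGeometry.Motives.RatFn.functionFieldMap π g = algebraMap (V.presheaf.stalk v) V.functionField u₀ ∧ ((∀ c : V.presheaf.stalk v, u₀ - c ^ p ∉ IsLocalRing.maximalIdeal (V.presheaf.stalk v)) ∨ (∃ c : V.presheaf.stalk v, u₀ - c ^ p ∈ IsLocalRing.maximalIdeal (V.presheaf.stalk v) ∧ u₀ - c ^ p ∉ IsLocalRing.maximalIdeal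 (V.presheaf.stalk v) ^ 2)))))) :=
  cleanModelsDimThree_of_logCleanPrincipalizationDimThree (cleanPatching3_of_stubs cleanLU3_of_stubs)

/-- THE SKELETON THEOREM (`#h21_check_skeleton`): the crux `Theses.RadicialJung.CleanModels` BY NAME from the declared
stubs — cases on `topologicalKrullDim W`. [folklore] -/
theorem CleanModels_of :
    Summit.ResolutionOfSingularities.ResolutionOfSingularities.Theses.RadicialJung.CleanModels := by
  intro p hp k _ _ W _ f L _ _ hs hl hq hr hpi hd
  by_cases h2 : topologicalKrullDim W ≤ 2
  · haveI := hs; haveI := hl; haveI := hq; haveI := hpi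
    exact cleanModels_dimLETwo_of_f75c stub_stacks0BICLocus p hp k W f hr L hd h2
  · by_cases h3' : topologicalKrullDim W ≤ 3
    · -- rev 36″: over an ALGEBRAICALLY CLOSED ground field the whole dim-≤3 slice is ONE printed theorem (Cossart 1987 / Posva 2024 Claim 5.1.2)
      by_cases halg : IsAlgClosed k
      · exact KbarQuasiProjective.cleanModels_algClosed_dimLEThree_of_cossartRational stub_cossart1987ThmRational
          p hp k W f L hs hl hq hr hpi hd halg h3'
      · exact cleanModelsDimThree_of_stubs p hp k W f L hs hl hq hr hpi hd h2 h3'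
    · exact stub_cleanModelsDimGEFour p hp k W f L hs hl hq hr hpi hd h3'

end Summit.ResolutionOfSingularities.ResolutionOfSingularities.Theorems.RadicialJung.CleanModels

end
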